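import Literature.Geometry.Riemannian.BakryEmeryCompleteGaffneyEnergy
import HarnessLib
/-!
# The weighted heat flow on a complete `CD(K,∞)` manifold with first-order (Gaffney) cut-offs, II: the cut-off entropy and
# Fisher information, the cut-off dissipation inequality, exponential decay of the Fisher information `I(ρ_s) ≤ e^{-2Ks} I(ρ₀)` and the
# integrated entropy production `H(ρ₀) − H(ρ_T) ≤ I(ρ₀)/2K` (Bakry–Émery 1985; Bakry–Gentil–Ledoux 2014 Thm. 5.2.1, Prop. 5.7.1)

**The entropy side of the Bakry–Émery argument on a COMPLETE `CD(K,∞)` weighted manifold with first-order (Gaffney) cut-offs**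
(D. Bakry, M. Émery, *Diffusions hypercontractives* (1985) [BakryEmery1985]; Bakry–Gentil–Ledoux (2014) Thm. 5.2.1 and Prop. 5.7.1,
pp. 236–240, 268, with the cut-off calculus of §3.2, pp. 141–147 [BakryGentilLedoux2014]; Carrillo–Ni, Comm. Anal. Geom. 17 (2009)
§3 [CarrilloNi2009]): the time derivative of the cut-off entropy `∫ η² ρ log ρ e^{-V}`, the kinematic identity
`∂ₜ|∇f_t|² = 2 g⁻¹(df_t, dḟ_t)`, the cut-off dissipation inequality of the Fisher information (Bochner + `CD(K,∞)` + the
`Γ₂`-slack), exponential decay of the Fisher information `I(ρ_s) ≤ e^{-2Ks} I(ρ₀)` for the energy-class flow, and the integrated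
entropy production `H(ρ₀) − H(ρ_T) ≤ (1 − e^{-2KT}) I(ρ₀)/2K ≤ I(ρ₀)/2K`.
RE-HOMED into `Literature/` by the Hodge foundations lane (`lit-hodgefound`, seat p20, generation 41): verbatim DECLARATION-LEVEL
ports, in dependency order and each under its original module docstring, of the theorems of the theorem-only modules
`Summits/SmoothPoincare4/SmoothPoincare4/Theorems/EntropyRung{NoncompactShrinkerGapHeat{EntropyCutoff, DissipationCutoff}, BakryEmeryLogSobolev{EntropyCutoff, Kinematic,
FisherPointwise, FisherDecay, EntropyProduction}}.lean`
(cell of the route `EntropyRung` of the smooth Poincaré 4 summit, where they served the analytic support item "Bakry–Émery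
logarithmic Sobolev inequality"; they certify classical heat-flow analysis on a complete weighted manifold and are independent
of that route's topological target), namespaces `Summit.SmoothPoincare4.SmoothPoincare4.Theorems.{NoncompactShrinkerGapHeat,
BakryEmeryComplete}` re-rooted as `Literature.Geometry.Riemannian.{NoncompactShrinkerGapHeat, BakryEmeryComplete}`.  The 24 theorems
of the same cone that other seats had already re-homed (`Geometry/Riemannian/{WeightedHeatCutoffCalculus, WeightedHeatFlowNoncompact,
LinearHeatVeryWeakNoncompact, LinearHeatWeakRegularityNoncompact, LinearHeatCauchyNoncompact}`, namespace
`Literature.Geometry.Riemannian`) are IMPORTED, not duplicated.  Everything is built on the tree's Literature layer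
`Literature/Geometry/{Riemannian, Lorentzian}/` (`PseudoRiemannianMetric`, `laplaceBeltrami`, `weightedLaplacian`, `gradSq`,
`innerDual`, `riemVolume`, Gaffney cut-offs `exists_cutoff_seq_of_isGeodesicallyComplete`, weighted Green identities, the linear
heat equation packages).  Theorem-only file: no definition, no named fact (D-0026); imports Mathlib/Literature only; every
declaration carries the citation of the printed step it formalises or serves.  The Summits originals stay in place (transitional
duplication; twins = same short names under `Summit.SmoothPoincare4.SmoothPoincare4.Theorems.…`).  Nothing here bears on any
summit statement.
Builds on `BakryEmeryCompleteGaffneyEnergy.lean`; consumed by `BakryEmeryCompleteLogSobolevHolds.lean` (same directory).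
-/

noncomputable section

/-!
## Part 1 — port of `Summits/SmoothPoincare4/SmoothPoincare4/Theorems/EntropyRungNoncompactShrinkerGapHeatEntropyCutoff.lean` (1 declarations kept)

# The time derivative of the cut-off entropy along the weighted heat flow on a complete weighted manifold

Helper of the registered stub `stub_compactSupportLSI` (heat-flow proof of the compact-support logarithmic Sobolev
inequality on the complete shrinker): the non-compact, cut-off version of `dH/dt = −I` (Carrillo–Ni 2009, (3.2)).
For `(M, g)` modelled on `ℝⁿ` (NOT compact), a smooth weight `V`, `L = Δ − g⁻¹(dV, d·)`, a positive `ρ` smooth on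
`M × S` with `∂ₜρ = Lρ`, and a smooth COMPACTLY SUPPORTED `η`, at every `t ∈ S`:

  `∫ η ∂ₜ(ρ log ρ e^{-V}) dV = −∫ η |∇ρ|²/ρ e^{-V} dV + ∫ (ρ log ρ)(Lη) e^{-V} dV`      (`entropyCutoff_eq`).

Proof: `∂ₜ(ρ log ρ) = (1 + log ρ) Lρ`; the weighted Green identity with the compactly supported factor
`η (1 + log ρ)` gives `−∫ η ⟨d log ρ, dρ⟩ e^{-V} − ∫ (1 + log ρ)⟨dη, dρ⟩ e^{-V}`; the first term is `−∫ η|∇ρ|²/ρ e^{-V}`,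
and since `(1 + log ρ) dρ = d(ρ log ρ)` the second is `∫ (ρ log ρ)(Lη) e^{-V}` by the weighted Green identity with
the compactly supported factor `η`. The last ("boundary") term is the only new feature relative to the closed case
(`hasDerivAt_entropy`, `BakryEmeryHeatFlow.lean`). Everything is proved; no definitions.
-/

section Part1

open scoped _root_.Manifold _root_.ContDiff _root_.ENNReal _root_.NNReal _root_.Topology
open _root_.MeasureTheory _root_.Set _root_.Filter
open Literature.Geometry.Lorentzian Literature.Geometry.Riemannian

namespace Literature.Geometry.Riemannian.NoncompactShrinkerGapHeat

section Entropy

variable {n : ℕ} {M : Type*} [TopologicalSpace M] [T2Space M] [SecondCountableTopology M]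
  [ChartedSpace (EuclideanSpace ℝ (Fin n)) M] [IsManifold (𝓡 n) ∞ M] [T3Space M] [MeasurableSpace M]
  [BorelSpace M]
  {g : PseudoRiemannianMetric (𝓡 n) ∞ (EuclideanSpace ℝ (Fin n)) (TangentSpace (𝓡 n) : M → Type _)}
  [g.HasLeviCivita]

omit [T2Space M] [SecondCountableTopology M] [T3Space M] [MeasurableSpace M] [BorelSpace M] [g.HasLeviCivita] in
/-- `g⁻¹(d(log ρ), β) = ρ⁻¹ g⁻¹(dρ, β)` at a point where `ρ > 0`. [cite: CarrilloNi2009, §3 (3.2)] -/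
theorem innerDual_mvfderiv_log_left {ρ : M → ℝ} {x : M} (hρ : MDifferentiableAt (𝓡 n) 𝓘(ℝ, ℝ) ρ x)
    (hpos : 0 < ρ x) (β : Module.Dual ℝ (TangentSpace (𝓡 n) x)) :
    g.innerDual x (mvfderiv (𝓡 n) (fun y ↦ Real.log (ρ y)) x).toLinearMap β =
      (ρ x)⁻¹ * g.innerDual x (mvfderiv (𝓡 n) ρ x).toLinearMap β := by
  have hd : HasDerivAt Real.log (ρ x)⁻¹ (ρ x) := Real.hasDerivAt_log hpos.ne'
  have hlin : (mvfderiv (𝓡 n) (fun y ↦ Real.log (ρ y)) x).toLinearMap =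
      (ρ x)⁻¹ • (mvfderiv (𝓡 n) ρ x).toLinearMap := by
    ext v
    have := mvfderiv_real_comp_apply (I := 𝓡 n) hd hρ v
    simpa [Function.comp_def] using this
  rw [hlin, g.innerDual_smul_left]

end Entropy

end Literature.Geometry.Riemannian.NoncompactShrinkerGapHeat

end Part1

/-!
## Part 2 — port of `Summits/SmoothPoincare4/SmoothPoincare4/Theorems/EntropyRungBakryEmeryLogSobolevEntropyCutoff.lean` (1 declarations kept)

# The time derivative of the cut-off entropy with a first-order (Gaffney) cut-off

Setting: `M` modelled on `ℝⁿ` (Hausdorff, second countable, `T₃`, Borel — NOT compact), `g` Riemannian with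
its Levi-Civita connection, `V` smooth (NO further assumption), `L = Δ_g − g⁻¹(dV, d·)`.

`entropyCutoffSq_le` — **de Bruijn's identity with a cut-off, first-order version**: for a positive `u` smooth
on `M × S` with `∂ₜu = Lu` within `S`, a smooth compactly supported cut-off `η` with `|η| ≤ 1` and
`|∇η|² ≤ δ²`, and a slice with `a ≤ u(t) ≤ b` (`a > 0`), `|∇u(t)|² ≤ C_G`, at `t ∈ S`:

  `|∫ η² ∂ₜ(u log u e^{-V}) + ∫ η² |∇u|²/u e^{-V}| ≤ 2 (1 + Λ) δ √C_G ∫ e^{-V}`,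
  `Λ = max(|log a|, |log b|)`:

`∂ₜ(u log u) = (1 + log u) Lu`; the weighted Green identity against the compactly supported factor
`(1 + log u) η²` (`integral_mul_cutoffSq_mul_weightedLaplacian`) gives
`∫η²(1+log u)(Lu)e^{-V} = −∫η² |∇u|²/u e^{-V} − 2∫(1+log u) η g⁻¹(dη, du) e^{-V}`, and
`|(1+log u) η g⁻¹(dη, du)| ≤ (1+Λ) δ √C_G`. Compare the shrinker toolkit's `entropyCutoff_eq` (error
`∫ u log u (Lη) e^{-V}`, which needs `|Lη| ≤ C`). Everything is proved; no definitions, no named facts.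

## References

* [BakryGentilLedoux2014] D. Bakry, I. Gentil, M. Ledoux (2014), Prop. 5.7.1 (p. 268, proof:
  `d/dt Ent(P_t f) = −I(P_t f)`) with §3.2 (pp. 141–147: cut-offs `ζ_k`, `Γ(ζ_k) ≤ 1/k`).
* [CarrilloNi2009] J. A. Carrillo, L. Ni, Comm. Anal. Geom. 17 (2009), §3 (3.2).
-/

section Part2

open scoped _root_.Manifold _root_.ContDiff _root_.ENNReal _root_.NNReal _root_.Topology
open _root_.MeasureTheory _root_.Set _root_.Filter
open Literature.Geometry.Lorentzian Literature.Geometry.Riemannian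

namespace Literature.Geometry.Riemannian.BakryEmeryComplete

open NoncompactShrinkerGapHeat

section Entropy

variable {n : ℕ} {M : Type*} [TopologicalSpace M] [T2Space M] [SecondCountableTopology M]
  [ChartedSpace (EuclideanSpace ℝ (Fin n)) M] [IsManifold (𝓡 n) ∞ M] [T3Space M] [MeasurableSpace M]
  [BorelSpace M]
  {g : PseudoRiemannianMetric (𝓡 n) ∞ (EuclideanSpace ℝ (Fin n)) (TangentSpace (𝓡 n) : M → Type _)}
  [g.HasLeviCivita]

/-- **de Bruijn's identity with a first-order cut-off** (see the module docstring): at `t ∈ S`,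
`|∫ η² ∂ₜ(u log u e^{-V}) + ∫ η² |∇u|²/u e^{-V}| ≤ 2(1 + Λ) δ √C_G ∫ e^{-V}`, `Λ = max(|log a|, |log b|)`.
[cite: BakryGentilLedoux2014, Prop. 5.7.1 (proof, p. 268) with §3.2 (pp. 141–147)]
[cite: CarrilloNi2009, §3 (3.2)] -/
theorem entropyCutoffSq_le (hg : g.IsRiemannian) {V : M → ℝ} (hV : ContMDiff (𝓡 n) 𝓘(ℝ, ℝ) ∞ V)
    (hw : Integrable (fun y ↦ Real.exp (-V y)) g.riemVolume)
    {u : ℝ → M → ℝ} {S : Set ℝ} (hS : UniqueDiffOn ℝ S)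
    (hu : ContMDiffOn ((𝓡 n).prod 𝓘(ℝ, ℝ)) 𝓘(ℝ, ℝ) ∞ (fun p : M × ℝ ↦ u p.2 p.1) (univ ×ˢ S))
    (heq : ∀ t ∈ S, ∀ y : M, derivWithin (fun s ↦ u s y) S t =
      g.dalembertian (u t) y
        - g.innerDual y (mvfderiv (𝓡 n) V y).toLinearMap (mvfderiv (𝓡 n) (u t) y).toLinearMap)
    {η : M → ℝ} (hη : ContMDiff (𝓡 n) 𝓘(ℝ, ℝ) ∞ η) (hηc : HasCompactSupport η) (hη1 : ∀ y, |η y| ≤ 1)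
    {δ : ℝ} (hδ : 0 ≤ δ) (hηgrad : ∀ y, g.gradSq η y ≤ δ ^ 2)
    {t : ℝ} (ht : t ∈ S) {a b CG : ℝ} (ha : 0 < a) (hab : ∀ y, a ≤ u t y ∧ u t y ≤ b)
    (hG : ∀ y, g.gradSq (u t) y ≤ CG) :
    |(∫ y, η y ^ 2 * derivWithin (fun s ↦ u s y * Real.log (u s y) * Real.exp (-V y)) S t ∂g.riemVolume)
      + ∫ y, η y ^ 2 * (g.gradSq (u t) y / u t y * Real.exp (-V y)) ∂g.riemVolume| ≤
      2 * (1 + max |Real.log a| |Real.log b|) * δ * Real.sqrt CG * ∫ y, Real.exp (-V y) ∂g.riemVolume := by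
  haveI := CarrilloNi2009_shrinkerLSI.isFiniteMeasureOnCompacts_riemVolume hg
  have h1le : (1 : ℕ∞ω) ≤ (∞ : ℕ∞ω) := WithTop.coe_le_coe.mpr le_top
  set μ : Measure M := g.riemVolume with hμ
  -- the slice at time `t` and its regularity
  have hF : ContMDiff (𝓡 n) 𝓘(ℝ, ℝ) ∞ (u t) :=
    hu.comp_contMDiff (contMDiff_id.prodMk contMDiff_const) fun y ↦ ⟨mem_univ _, ht⟩
  have hpt : ∀ y, 0 < u t y := fun y ↦ ha.trans_le (hab y).1
  have hlogF : ContMDiff (𝓡 n) 𝓘(ℝ, ℝ) ∞ (fun y ↦ Real.log (u t y)) := fun y ↦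
    ((Real.contDiffAt_log.2 (hpt y).ne').contMDiffAt).comp y (hF y)
  have hA : ContMDiff (𝓡 n) 𝓘(ℝ, ℝ) ∞ (fun y ↦ 1 + Real.log (u t y)) := contMDiff_const.add hlogF
  -- the pointwise time derivative: `∂ₜ(u log u e^{-V}) = (1 + log u)(Lu) e^{-V}`
  have hfd : ∀ y, HasDerivWithinAt (fun s ↦ u s y) (derivWithin (fun s ↦ u s y) S t) S t := fun y ↦
    hasDerivWithinAt_time_of_contMDiffOn (by simp) hu y ht
  have hprod : ∀ y, derivWithin (fun s ↦ u s y * Real.log (u s y) * Real.exp (-V y)) S t =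
      (1 + Real.log (u t y)) * (g.dalembertian (u t) y
        - g.innerDual y (mvfderiv (𝓡 n) V y).toLinearMap (mvfderiv (𝓡 n) (u t) y).toLinearMap)
        * Real.exp (-V y) := by
    intro y
    have hl : HasDerivWithinAt (fun s ↦ Real.log (u s y))
        ((u t y)⁻¹ * derivWithin (fun s ↦ u s y) S t) S t := by
      have := (Real.hasDerivAt_log (hpt y).ne').comp_hasDerivWithinAt t (hfd y)
      simpa [Function.comp_def] using this
    have hm : HasDerivWithinAt (fun s ↦ u s y * Real.log (u s y))
        (derivWithin (fun s ↦ u s y) S t * Real.log (u t y)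
          + u t y * ((u t y)⁻¹ * derivWithin (fun s ↦ u s y) S t)) S t := (hfd y).mul hl
    have h : derivWithin (fun s ↦ u s y * Real.log (u s y) * Real.exp (-V y)) S t =
        (derivWithin (fun s ↦ u s y) S t * Real.log (u t y)
          + u t y * ((u t y)⁻¹ * derivWithin (fun s ↦ u s y) S t)) * Real.exp (-V y) :=
      (hm.mul_const (Real.exp (-V y))).derivWithin (hS t ht)
    have key : u t y * ((u t y)⁻¹ * derivWithin (fun s ↦ u s y) S t) = derivWithin (fun s ↦ u s y) S t := by
      rw [← mul_assoc, mul_inv_cancel₀ (hpt y).ne', one_mul]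
    rw [h, key, heq t ht y]
    ring
  -- the Green identity against `(1 + log u) η²`
  have hid := integral_mul_cutoffSq_mul_weightedLaplacian hg (a := fun y ↦ 1 + Real.log (u t y)) hA hF hη hηc hV
  have hFd : ∀ y, MDifferentiableAt (𝓡 n) 𝓘(ℝ, ℝ) (u t) y := fun y ↦ hF.mdifferentiableAt (by simp)
  have hdA : ∀ y, g.innerDual y (mvfderiv (𝓡 n) (fun z ↦ 1 + Real.log (u t z)) y).toLinearMap
      (mvfderiv (𝓡 n) (u t) y).toLinearMap = g.gradSq (u t) y / u t y := by
    intro y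
    have hlogd : MDifferentiableAt (𝓡 n) 𝓘(ℝ, ℝ) (fun z ↦ Real.log (u t z)) y := hlogF.mdifferentiableAt (by simp)
    have e1 : (mvfderiv (𝓡 n) (fun z ↦ 1 + Real.log (u t z)) y).toLinearMap =
        (mvfderiv (𝓡 n) (fun z ↦ Real.log (u t z)) y).toLinearMap := by
      rw [mvfderiv_fun_add mdifferentiableAt_const hlogd, mvfderiv_const, zero_add]
    rw [e1, innerDual_mvfderiv_log_left (hFd y) (hpt y)]
    have : g.innerDual y (mvfderiv (𝓡 n) (u t) y).toLinearMap (mvfderiv (𝓡 n) (u t) y).toLinearMap =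
        g.gradSq (u t) y := rfl
    rw [this, div_eq_inv_mul]
  -- continuity, integrability
  have hWc : Continuous fun y ↦ Real.exp (-V y) := Real.continuous_exp.comp hV.continuous.neg
  have hηcont : Continuous η := hη.continuous
  have hη2c : HasCompactSupport (fun y ↦ η y ^ 2) := by
    rw [show (fun y ↦ η y ^ 2) = fun y ↦ η y * η y from funext fun y ↦ sq (η y)]
    exact hηc.mul_right
  have hAc : Continuous fun y ↦ 1 + Real.log (u t y) := hA.continuous
  have hIηF : Continuous fun y ↦ g.innerDual y (mvfderiv (𝓡 n) η y).toLinearMap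
      (mvfderiv (𝓡 n) (u t) y).toLinearMap := continuous_innerDual_mvfderiv g (hη.of_le h1le) (hF.of_le h1le)
  have hQc : Continuous fun y ↦ g.gradSq (u t) y / u t y :=
    (contMDiff_gradSq g hF).continuous.div hF.continuous fun y ↦ (hpt y).ne'
  -- (i) the left integral equals `∫ (1 + log u) η² (Lu) e^{-V}`
  have e0 : ∫ y, η y ^ 2 * derivWithin (fun s ↦ u s y * Real.log (u s y) * Real.exp (-V y)) S t ∂μ =
      ∫ y, (1 + Real.log (u t y)) * η y ^ 2 * (g.dalembertian (u t) y
        - g.innerDual y (mvfderiv (𝓡 n) V y).toLinearMap (mvfderiv (𝓡 n) (u t) y).toLinearMap) *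
        Real.exp (-V y) ∂μ :=
    integral_congr_ae (Eventually.of_forall fun y ↦ by dsimp only; rw [hprod y]; ring)
  -- (ii) the first Green term is the cut-off Fisher information
  have e1 : ∫ y, η y ^ 2 * g.innerDual y (mvfderiv (𝓡 n) (fun z ↦ 1 + Real.log (u t z)) y).toLinearMap
      (mvfderiv (𝓡 n) (u t) y).toLinearMap * Real.exp (-V y) ∂μ =
      ∫ y, η y ^ 2 * (g.gradSq (u t) y / u t y * Real.exp (-V y)) ∂μ :=
    integral_congr_ae (Eventually.of_forall fun y ↦ by dsimp only; rw [hdA y]; ring)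
  -- (iii) the error term is bounded pointwise
  set Λ : ℝ := max |Real.log a| |Real.log b| with hΛ
  have hCG0 : ∀ y : M, 0 ≤ CG := fun y ↦ (g.gradSq_nonneg hg _ y).trans (hG y)
  have hlogbd : ∀ y, |1 + Real.log (u t y)| ≤ 1 + Λ := by
    intro y
    have h := abs_add_le (1 : ℝ) (Real.log (u t y))
    rw [abs_one] at h
    have h2 : |Real.log (u t y)| ≤ Λ := by
      rw [abs_le]
      constructor
      · have h3 : Real.log a ≤ Real.log (u t y) := Real.log_le_log ha (hab y).1
        linarith [neg_abs_le (Real.log a), le_max_left |Real.log a| |Real.log b|]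
      · have h3 : Real.log (u t y) ≤ Real.log b := Real.log_le_log (hpt y) (hab y).2
        linarith [le_abs_self (Real.log b), le_max_right |Real.log a| |Real.log b|]
    linarith
  have herr : ∀ y, |(1 + Real.log (u t y)) * η y * g.innerDual y (mvfderiv (𝓡 n) η y).toLinearMap
      (mvfderiv (𝓡 n) (u t) y).toLinearMap * Real.exp (-V y)| ≤ (1 + Λ) * δ * Real.sqrt CG * Real.exp (-V y) := by
    intro y
    have hI := abs_innerDual_le_sqrt_gradSq_mul hg η (u t) y
    have h2 : Real.sqrt (g.gradSq η y) ≤ δ := by rw [← Real.sqrt_sq hδ]; exact Real.sqrt_le_sqrt (hηgrad y)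
    have h3 : Real.sqrt (g.gradSq (u t) y) ≤ Real.sqrt CG := Real.sqrt_le_sqrt (hG y)
    have hI' : |g.innerDual y (mvfderiv (𝓡 n) η y).toLinearMap (mvfderiv (𝓡 n) (u t) y).toLinearMap| ≤
        δ * Real.sqrt CG := hI.trans (mul_le_mul h2 h3 (Real.sqrt_nonneg _) hδ)
    rw [abs_mul, abs_mul, abs_mul, abs_of_nonneg (Real.exp_pos _).le]
    have hW0 : 0 ≤ Real.exp (-V y) := (Real.exp_pos _).le
    calc |1 + Real.log (u t y)| * |η y| *
          |g.innerDual y (mvfderiv (𝓡 n) η y).toLinearMap (mvfderiv (𝓡 n) (u t) y).toLinearMap| * Real.exp (-V y)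
        ≤ (1 + Λ) * 1 * (δ * Real.sqrt CG) * Real.exp (-V y) := by
          refine mul_le_mul_of_nonneg_right ?_ hW0
          exact mul_le_mul (mul_le_mul (hlogbd y) (hη1 y) (abs_nonneg _) (by positivity)) hI'
            (abs_nonneg _) (by positivity)
      _ = (1 + Λ) * δ * Real.sqrt CG * Real.exp (-V y) := by ring
  have iErr : Integrable (fun y ↦ (1 + Real.log (u t y)) * η y * g.innerDual y
      (mvfderiv (𝓡 n) η y).toLinearMap (mvfderiv (𝓡 n) (u t) y).toLinearMap * Real.exp (-V y)) μ :=
    integrable_of_continuous_of_hasCompactSupport' hg (((hAc.mul hηcont).mul hIηF).mul hWc)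
      (((hηc.mul_left).mul_right).mul_right)
  have hEbd : |∫ y, (1 + Real.log (u t y)) * η y * g.innerDual y (mvfderiv (𝓡 n) η y).toLinearMap
      (mvfderiv (𝓡 n) (u t) y).toLinearMap * Real.exp (-V y) ∂μ| ≤ (1 + Λ) * δ * Real.sqrt CG *
        ∫ y, Real.exp (-V y) ∂μ := by
    calc |∫ y, (1 + Real.log (u t y)) * η y * g.innerDual y (mvfderiv (𝓡 n) η y).toLinearMap
          (mvfderiv (𝓡 n) (u t) y).toLinearMap * Real.exp (-V y) ∂μ|
        ≤ ∫ y, |(1 + Real.log (u t y)) * η y * g.innerDual y (mvfderiv (𝓡 n) η y).toLinearMap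
          (mvfderiv (𝓡 n) (u t) y).toLinearMap * Real.exp (-V y)| ∂μ := abs_integral_le_integral_abs
      _ ≤ ∫ y, (1 + Λ) * δ * Real.sqrt CG * Real.exp (-V y) ∂μ :=
          integral_mono iErr.abs (hw.const_mul _) herr
      _ = (1 + Λ) * δ * Real.sqrt CG * ∫ y, Real.exp (-V y) ∂μ := integral_const_mul _ _
  -- conclusion
  rw [e0, hid, e1]
  have e2 : -(∫ y, η y ^ 2 * (g.gradSq (u t) y / u t y * Real.exp (-V y)) ∂μ)
      - 2 * ∫ y, (1 + Real.log (u t y)) * η y * g.innerDual y (mvfderiv (𝓡 n) η y).toLinearMap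
          (mvfderiv (𝓡 n) (u t) y).toLinearMap * Real.exp (-V y) ∂μ
      + ∫ y, η y ^ 2 * (g.gradSq (u t) y / u t y * Real.exp (-V y)) ∂μ =
      -2 * ∫ y, (1 + Real.log (u t y)) * η y * g.innerDual y (mvfderiv (𝓡 n) η y).toLinearMap
          (mvfderiv (𝓡 n) (u t) y).toLinearMap * Real.exp (-V y) ∂μ := by ring
  rw [e2, abs_mul, show |(-2 : ℝ)| = 2 by norm_num]
  linarith [hEbd]

end Entropy

end Literature.Geometry.Riemannian.BakryEmeryComplete

end Part2

/-!
## Part 3 — port of `Summits/SmoothPoincare4/SmoothPoincare4/Theorems/EntropyRungBakryEmeryLogSobolevKinematic.lean` (1 declarations kept)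

# The kinematic identity `∂ₜ|∇f_t|² = 2 g⁻¹(df_t, dḟ_t)` for a static metric

For a family `f` smooth on `M × S` (`S` a time set with unique derivatives,
`S ⊆ closure (interior S)`) on a manifold modelled on `ℝⁿ` with a (static) metric `g`, the
derivative within `S` of `|∇f_t|²(x)` is `2 g⁻¹(df_t, dḟ_t)(x)`, `ḟ_t(y) = derivWithin (f · y) S t` —
the manifold reading of `MetricCoord.IsMetricOn.hasDerivWithinAt_gradSqAt_static` through the chart
bridges of `BakryEmeryHeatFlow.lean` (compare `deriv_gradSq_of_heatFlow_isOpen`, which substitutes the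
heat equation). Used by the first-order Fisher dissipation inequality
(`EntropyRungBakryEmeryLogSobolevFisherPointwise.lean`). Everything is proved; no definitions.

## References

* [Topping2006] P. Topping, *Lectures on the Ricci flow* (2006), proof of Prop. 6.2.1 (static case).
* [CarrilloNi2009] J. A. Carrillo, L. Ni, Comm. Anal. Geom. 17 (2009), §3 (p. 8).
-/

section Part3

open scoped _root_.Manifold _root_.ContDiff _root_.ENNReal _root_.NNReal _root_.Topology
open _root_.MeasureTheory _root_.Set _root_.Filter
open Literature.Geometry.Lorentzian Literature.Geometry.Riemannian

namespace Literature.Geometry.Riemannian.BakryEmeryComplete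

section Kinematic

variable {n : ℕ} {M : Type*} [TopologicalSpace M] [ChartedSpace (EuclideanSpace ℝ (Fin n)) M]
  [IsManifold (𝓡 n) ∞ M]
  {g : PseudoRiemannianMetric (𝓡 n) ∞ (EuclideanSpace ℝ (Fin n)) (TangentSpace (𝓡 n) : M → Type _)}

/-- **`∂ₜ|∇f_t|² = 2 g⁻¹(df_t, dḟ_t)` for a static metric** (general time set `S` with unique
derivatives and `S ⊆ closure (interior S)`, `ḟ` the derivative within `S`): the chart computation of
`MetricCoord.IsMetricOn.hasDerivWithinAt_gradSqAt_static`; `ḟ(t, ·)` is smooth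
(`contMDiffOn_derivWithin_time_of_uniqueDiffOn`). [cite: BakryGentilLedoux2014, §3.2 (pp. 141–147) and Prop. 5.7.1 (p. 268: the time derivative of the Fisher integrand)] -/
theorem derivWithin_gradSq_eq_two_innerDual {f : ℝ → M → ℝ} {S : Set ℝ} (hS : UniqueDiffOn ℝ S)
    (hS' : S ⊆ closure (interior S))
    (hf : ContMDiffOn ((𝓡 n).prod 𝓘(ℝ, ℝ)) 𝓘(ℝ, ℝ) ∞ (fun p : M × ℝ ↦ f p.2 p.1) (univ ×ˢ S))
    {t : ℝ} (ht : t ∈ S) (x : M) :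
    derivWithin (fun s ↦ g.gradSq (f s) x) S t =
      2 * g.innerDual x (mvfderiv (𝓡 n) (f t) x).toLinearMap
        (mvfderiv (𝓡 n) (fun y ↦ derivWithin (fun s ↦ f s y) S t) x).toLinearMap := by
  -- the chart at `x`
  set G := chartRep (𝓡 n) (fun _ ↦ g) x 0 with hGdef
  have hGm : MetricCoord.IsMetricOn G (extChartAt (𝓡 n) x).target :=
    OpensChart.isMetricOn_repr (val_chartPullback_eq_chartRep (fun _ : ℝ ↦ g) x 0)
  set Fh : ℝ → EuclideanSpace ℝ (Fin n) → ℝ := fun s z ↦ f s ((extChartAt (𝓡 n) x).symm z)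
    with hFhdef
  have hu0 : extChartAt (𝓡 n) x x ∈ (extChartAt (𝓡 n) x).target := mem_extChartAt_target x
  set u₀ : chartTarget (𝓡 n) x := ⟨extChartAt (𝓡 n) x x, hu0⟩ with hu₀def
  have hΦu₀ : chartInv (𝓡 n) x u₀ = x := extChartAt_to_inv x
  have hslice : ∀ s ∈ S, ContMDiff (𝓡 n) 𝓘(ℝ, ℝ) ∞ (f s) := fun s hs ↦
    contMDiff_slice_of_contMDiffOn hf hs
  have hFh : ContDiffOn ℝ ∞ (fun p : EuclideanSpace ℝ (Fin n) × ℝ ↦ Fh p.2 p.1)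
      ((extChartAt (𝓡 n) x).target ×ˢ S) :=
    contDiffOn_family_comp_extChartAt_symm hf x
  have hft : ContMDiff (𝓡 n) 𝓘(ℝ, ℝ) ∞ (f t) := hslice t ht
  have hfd : ∀ y, MDifferentiableAt (𝓡 n) 𝓘(ℝ, ℝ) (f t) y := fun y ↦ hft.mdifferentiableAt (by simp)
  -- the time derivative `ḟ(t, ·)` is smooth
  have hdotfam := contMDiffOn_derivWithin_time_of_uniqueDiffOn (I := 𝓡 n) (u := f) hS hf
  have hdot : ContMDiff (𝓡 n) 𝓘(ℝ, ℝ) ∞ (fun y ↦ derivWithin (fun s ↦ f s y) S t) :=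
    hdotfam.comp_contMDiff (contMDiff_id.prodMk contMDiff_const) fun y ↦ ⟨mem_univ _, ht⟩
  have hdotd : MDifferentiableAt (𝓡 n) 𝓘(ℝ, ℝ) (fun y ↦ derivWithin (fun s ↦ f s y) S t)
      (chartInv (𝓡 n) x u₀) := hdot.mdifferentiableAt (by simp)
  -- (a) `|∇f_s|²(x)` read in the chart, for `s ∈ S`
  have hgrad : ∀ s ∈ S, g.gradSq (f s) x = MetricCoord.gradSqAt G (Fh s) (extChartAt (𝓡 n) x x) := by
    intro s hs
    have h := gradSq_chartInv_eq g x u₀ (F := f s) ((hslice s hs).mdifferentiableAt (by simp))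
    rw [hΦu₀] at h
    exact h
  have hderiv : derivWithin (fun s ↦ g.gradSq (f s) x) S t =
      derivWithin (fun s ↦ MetricCoord.gradSqAt G (Fh s) (extChartAt (𝓡 n) x x)) S t :=
    derivWithin_congr (fun s hs ↦ hgrad s hs) (hgrad t ht)
  -- (b) the coordinate time derivative
  have hcoord := (hGm.hasDerivWithinAt_gradSqAt_static hS hS' hFh hu0 ht).derivWithin (hS t ht)
  -- (c) `ḟ` in the chart is the representative of `ḟ(t, ·)`
  have hrep : MetricCoord.tDerivFun Fh S t =
      ((fun y ↦ derivWithin (fun s ↦ f s y) S t) ∘ (extChartAt (𝓡 n) x).symm) := by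
    funext z
    simp only [MetricCoord.tDerivFun, Function.comp_apply, hFhdef]
  -- (d) the bridge for `g⁻¹(df, dḟ)`
  have hI : g.innerDual x (mvfderiv (𝓡 n) (f t) x).toLinearMap
      (mvfderiv (𝓡 n) (fun y ↦ derivWithin (fun s ↦ f s y) S t) x).toLinearMap =
      fderiv ℝ (MetricCoord.tDerivFun Fh S t) (extChartAt (𝓡 n) x x)
        (MetricCoord.sharpAt G (extChartAt (𝓡 n) x x) (fderiv ℝ (Fh t) (extChartAt (𝓡 n) x x))) := by
    have h := innerDual_chartInv_eq g x u₀ (hfd _) hdotd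
    rw [hΦu₀] at h
    rw [show (mvfderiv (𝓡 n) (f t) x).toLinearMap = (mvfderiv (𝓡 n) (f t) x : TangentSpace (𝓡 n) x →ₗ[ℝ] ℝ)
        from rfl,
      show (mvfderiv (𝓡 n) (fun y ↦ derivWithin (fun s ↦ f s y) S t) x).toLinearMap =
        (mvfderiv (𝓡 n) (fun y ↦ derivWithin (fun s ↦ f s y) S t) x : TangentSpace (𝓡 n) x →ₗ[ℝ] ℝ)
        from rfl, h,
      MetricCoord.apply_sharpAt_comm (hGm.isInvertible _ hu0) (hGm.symm _ hu0), hrep]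
    rfl
  rw [hderiv, hcoord, hI]

end Kinematic

end Literature.Geometry.Riemannian.BakryEmeryComplete

end Part3

/-!
## Part 4 — port of `Summits/SmoothPoincare4/SmoothPoincare4/Theorems/EntropyRungBakryEmeryLogSobolevFisherPointwise.lean` (1 declarations kept)

# The cut-off dissipation inequality of the Fisher information with a first-order (Gaffney)
# cut-off

Setting: `M` modelled on `ℝⁿ` (Hausdorff, second countable, `T₃`, Borel — NOT compact), `g`
Riemannian with its Levi-Civita connection, `V` smooth with `Ric + Hess V ≥ K g` (NO other
assumption on `V`), `L = Δ_g − g⁻¹(dV, d·)`, weight `e^{-V} dV_g`.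

* `fisher_cutoffSq_le` — **the dissipation inequality of the cut-off Fisher information in
  `φ`-form, first-order version.** For `φ` smooth on `M × S` solving `∂ₜφ = Lφ − |∇φ|²` (the
  equation of `φ = −log u` along the weighted heat flow `∂ₜu = Lu`), a smooth compactly supported
  cut-off `η` with `|η| ≤ 1`, `|∇η|² ≤ δ²`, and a slice with `|∇φ(t)|² ≤ L₀²` and
  `|∇φ|² e^{-φ} e^{-V} ∈ L¹` at time `t`:
  `∫ η² ∂ₜ(|∇φ|² e^{-φ} e^{-V}) ≤ −2K ∫ η² |∇φ|² e^{-φ} e^{-V} + (2δ² + 2δL₀) ∫ |∇φ|² e^{-φ} e^{-V}`.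

Proof: with `Q = |∇φ|²`, `∂ₜ(Q e^{-φ}) = e^{-φ}(2g⁻¹(dφ, d(Lφ)) − 2g⁻¹(dφ, dQ) − Q Lφ + Q²)`;
`2 g⁻¹(dφ, d(Lφ)) = LQ − 2KQ − 2S` with the slack `S ≥ 0` of the pointwise `Γ₂ ≥ KΓ` inequality
(`weightedBochner_pointwise_ge`); the two weighted Green identities against the compactly supported
factors `e^{-φ}η²` and `e^{-φ}Qη²` (`integral_mul_cutoffSq_mul_weightedLaplacian`) leave
`−2K I_η − 2∫η²Se^{-φ}e^{-V} − 2∫e^{-φ}η g⁻¹(dη,dQ)e^{-V} + 2∫e^{-φ}Qη g⁻¹(dη,dφ)e^{-V}`; the Hessian error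
`g⁻¹(dη, dQ)` is absorbed into `S` (`innerDual_gradSq_sq_le_slack`, `slack_absorb`), and the cubic
term is `≤ 2δL₀ Q e^{-φ}`. This replaces the `|Lη| ≤ C` error term of the shrinker toolkit's
`fisherCutoff_le`. Everything is proved; no definitions, no named facts.

## References

* [BakryGentilLedoux2014] D. Bakry, I. Gentil, M. Ledoux (2014), Prop. 5.7.1 (p. 268) with §3.2
  (pp. 141–147: cut-offs `ζ_k`, `Γ(ζ_k) ≤ 1/k`) and §C.6.
* [CarrilloNi2009] J. A. Carrillo, L. Ni, Comm. Anal. Geom. 17 (2009), §3 (p. 8) and §4.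
* [BakryEmery1985] D. Bakry, M. Émery, LNM 1123 (1985) 177–206.
-/

section Part4

open scoped _root_.Manifold _root_.ContDiff _root_.ENNReal _root_.NNReal _root_.Topology
open _root_.MeasureTheory _root_.Set _root_.Filter
open Literature.Geometry.Lorentzian Literature.Geometry.Riemannian

namespace Literature.Geometry.Riemannian.BakryEmeryComplete

open NoncompactShrinkerGapHeat NoncompactShrinkerGapHeat.CutoffToolkit

section Fisher

variable {n : ℕ} {M : Type*} [TopologicalSpace M] [T2Space M] [SecondCountableTopology M]
  [ChartedSpace (EuclideanSpace ℝ (Fin n)) M] [IsManifold (𝓡 n) ∞ M] [T3Space M]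
  [MeasurableSpace M] [BorelSpace M]
  {g : PseudoRiemannianMetric (𝓡 n) ∞ (EuclideanSpace ℝ (Fin n)) (TangentSpace (𝓡 n) : M → Type _)}
  [g.HasLeviCivita]

/-- **The dissipation inequality of the cut-off Fisher information, first-order version** (see the
module docstring): at `t ∈ S`,
`∫ η² ∂ₜ(|∇φ|²e^{-φ}e^{-V}) ≤ −2K ∫ η²|∇φ|²e^{-φ}e^{-V} + (2δ² + 2δL₀) ∫ |∇φ|²e^{-φ}e^{-V}` for
`φ` solving `∂ₜφ = Lφ − |∇φ|²` within `S`, `|η| ≤ 1`, `|∇η|² ≤ δ²`, `|∇φ(t)|² ≤ L₀²`,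
`|∇φ(t)|²e^{-φ(t)}e^{-V} ∈ L¹`. [cite: BakryGentilLedoux2014, Prop. 5.7.1 (p. 268) with §3.2 (pp. 141–147)]
[cite: CarrilloNi2009, §3 (p. 8)] -/
theorem fisher_cutoffSq_le (hg : g.IsRiemannian) {V : M → ℝ} {K : ℝ}
    (hV : ContMDiff (𝓡 n) 𝓘(ℝ, ℝ) ∞ V)
    (hRic : ∀ (y : M) (X : TangentSpace (𝓡 n) y), K * g.val y X X ≤ g.ricci y X X + g.hessian V y X X)
    {φ : ℝ → M → ℝ} {S : Set ℝ} (hS : UniqueDiffOn ℝ S) (hS' : S ⊆ closure (interior S))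
    (hφ : ContMDiffOn ((𝓡 n).prod 𝓘(ℝ, ℝ)) 𝓘(ℝ, ℝ) ∞ (fun p : M × ℝ ↦ φ p.2 p.1) (univ ×ˢ S))
    (heq : ∀ t ∈ S, ∀ y : M, derivWithin (fun s ↦ φ s y) S t =
      g.dalembertian (φ t) y
        - g.innerDual y (mvfderiv (𝓡 n) V y).toLinearMap (mvfderiv (𝓡 n) (φ t) y).toLinearMap
        - g.gradSq (φ t) y)
    {η : M → ℝ} (hη : ContMDiff (𝓡 n) 𝓘(ℝ, ℝ) ∞ η) (hηc : HasCompactSupport η) (hη1 : ∀ y, |η y| ≤ 1)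
    {δ : ℝ} (hδ : 0 ≤ δ) (hηgrad : ∀ y, g.gradSq η y ≤ δ ^ 2)
    {t : ℝ} (ht : t ∈ S) {L₀ : ℝ} (hL₀ : 0 ≤ L₀) (hφgrad : ∀ y, g.gradSq (φ t) y ≤ L₀ ^ 2)
    (hint : Integrable (fun y ↦ g.gradSq (φ t) y * Real.exp (-φ t y) * Real.exp (-V y)) g.riemVolume) :
    ∫ y, η y ^ 2 * derivWithin (fun s ↦ g.gradSq (φ s) y * Real.exp (-φ s y) * Real.exp (-V y)) S t
        ∂g.riemVolume ≤
      -2 * K * ∫ y, η y ^ 2 * (g.gradSq (φ t) y * Real.exp (-φ t y) * Real.exp (-V y)) ∂g.riemVolume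
      + (2 * δ ^ 2 + 2 * δ * L₀) *
          ∫ y, g.gradSq (φ t) y * Real.exp (-φ t y) * Real.exp (-V y) ∂g.riemVolume := by
  haveI := CarrilloNi2009_shrinkerLSI.isFiniteMeasureOnCompacts_riemVolume hg
  have h1le : (1 : ℕ∞ω) ≤ (∞ : ℕ∞ω) := WithTop.coe_le_coe.mpr le_top
  have h2le : (2 : ℕ∞ω) ≤ (∞ : ℕ∞ω) := WithTop.coe_le_coe.mpr le_top
  set μ : Measure M := g.riemVolume with hμ
  /- the static functions at time `t` -/
  set F : M → ℝ := φ t with hFdef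
  have hF : ContMDiff (𝓡 n) 𝓘(ℝ, ℝ) ∞ F :=
    hφ.comp_contMDiff (contMDiff_id.prodMk contMDiff_const) fun y ↦ ⟨mem_univ _, ht⟩
  set Q : M → ℝ := g.gradSq F with hQdef
  have hQ : ContMDiff (𝓡 n) 𝓘(ℝ, ℝ) ∞ Q := contMDiff_gradSq g hF
  set LF : M → ℝ := fun y ↦ g.dalembertian F y
    - g.innerDual y (mvfderiv (𝓡 n) V y).toLinearMap (mvfderiv (𝓡 n) F y).toLinearMap with hLFdef
  have hLF : ContMDiff (𝓡 n) 𝓘(ℝ, ℝ) ∞ LF := (contMDiff_dalembertian g hF).sub (contMDiff_innerDual g hV hF)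
  set LQ : M → ℝ := fun y ↦ g.dalembertian Q y
    - g.innerDual y (mvfderiv (𝓡 n) V y).toLinearMap (mvfderiv (𝓡 n) Q y).toLinearMap with hLQdef
  set Sl : M → ℝ := fun y ↦ (1 / 2) * LQ y
    - g.innerDual y (mvfderiv (𝓡 n) F y).toLinearMap (mvfderiv (𝓡 n) LF y).toLinearMap - K * Q y
    with hSldef
  set E : M → ℝ := fun y ↦ Real.exp (-F y) with hEdef
  have hE : ContMDiff (𝓡 n) 𝓘(ℝ, ℝ) ∞ E := (Real.contDiff_exp.comp contDiff_neg).comp_contMDiff hF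
  have hE0 : ∀ y, 0 ≤ E y := fun y ↦ (Real.exp_pos _).le
  have hW : Continuous fun y ↦ Real.exp (-V y) := Real.continuous_exp.comp hV.continuous.neg
  have hSl0 : ∀ y, 0 ≤ Sl y := fun y ↦ by
    have h := weightedBochner_pointwise_ge g hg hV hRic hF y
    simp only [hSldef, hLQdef, hQdef, hLFdef]
    linarith [h]
  have hslack : ∀ y, (g.innerDual y (mvfderiv (𝓡 n) η y).toLinearMap
      (mvfderiv (𝓡 n) Q y).toLinearMap) ^ 2 ≤ 4 * g.gradSq η y * Q y * Sl y := fun y ↦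
    innerDual_gradSq_sq_le_slack g hg hV hRic hF hη y
  -- differentiability
  have hFd : ∀ y, MDifferentiableAt (𝓡 n) 𝓘(ℝ, ℝ) F y := fun y ↦ hF.mdifferentiableAt (by simp)
  have hQd : ∀ y, MDifferentiableAt (𝓡 n) 𝓘(ℝ, ℝ) Q y := fun y ↦ hQ.mdifferentiableAt (by simp)
  have hLFd : ∀ y, MDifferentiableAt (𝓡 n) 𝓘(ℝ, ℝ) LF y := fun y ↦ hLF.mdifferentiableAt (by simp)
  have hEd : ∀ y, MDifferentiableAt (𝓡 n) 𝓘(ℝ, ℝ) E y := fun y ↦ hE.mdifferentiableAt (by simp)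
  /- Step 1: the time derivative, pointwise -/
  have hdot_eq : (fun y ↦ derivWithin (fun s ↦ φ s y) S t) = fun y ↦ LF y - Q y := funext fun y ↦ heq t ht y
  have hqd : ∀ y, derivWithin (fun s ↦ g.gradSq (φ s) y) S t =
      2 * (g.innerDual y (mvfderiv (𝓡 n) F y).toLinearMap (mvfderiv (𝓡 n) LF y).toLinearMap
        - g.innerDual y (mvfderiv (𝓡 n) F y).toLinearMap (mvfderiv (𝓡 n) Q y).toLinearMap) := by
    intro y
    rw [derivWithin_gradSq_eq_two_innerDual (g := g) hS hS' hφ ht y, hdot_eq,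
      mvfderiv_fun_sub (hLFd y) (hQd y), ContinuousLinearMap.toLinearMap_sub,
      g.innerDual_comm y (mvfderiv (𝓡 n) F y).toLinearMap, g.innerDual_sub_left,
      g.innerDual_comm y (mvfderiv (𝓡 n) LF y).toLinearMap, g.innerDual_comm y (mvfderiv (𝓡 n) Q y).toLinearMap]
  have hfd : ∀ y, HasDerivWithinAt (fun s ↦ φ s y) (derivWithin (fun s ↦ φ s y) S t) S t := fun y ↦
    hasDerivWithinAt_time_of_contMDiffOn (by simp) hφ y ht
  have hqfam := contMDiffOn_gradSq_family g hS hφ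
  have hqd' : ∀ y, HasDerivWithinAt (fun s ↦ g.gradSq (φ s) y)
      (derivWithin (fun s ↦ g.gradSq (φ s) y) S t) S t := fun y ↦
    hasDerivWithinAt_time_of_contMDiffOn (by simp) hqfam y ht
  have hder : ∀ y, derivWithin (fun s ↦ g.gradSq (φ s) y * Real.exp (-φ s y) * Real.exp (-V y)) S t =
      (2 * g.innerDual y (mvfderiv (𝓡 n) F y).toLinearMap (mvfderiv (𝓡 n) LF y).toLinearMap
        - 2 * g.innerDual y (mvfderiv (𝓡 n) F y).toLinearMap (mvfderiv (𝓡 n) Q y).toLinearMap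
        - Q y * LF y + Q y ^ 2) * E y * Real.exp (-V y) := by
    intro y
    have hu : HasDerivWithinAt (fun s ↦ Real.exp (-φ s y))
        (Real.exp (-φ t y) * -(derivWithin (fun s ↦ φ s y) S t)) S t := ((hfd y).neg).exp
    have h : derivWithin (fun s ↦ g.gradSq (φ s) y * Real.exp (-φ s y) * Real.exp (-V y)) S t =
        (derivWithin (fun s ↦ g.gradSq (φ s) y) S t * Real.exp (-φ t y)
          + g.gradSq (φ t) y * (Real.exp (-φ t y) * -(derivWithin (fun s ↦ φ s y) S t))) * Real.exp (-V y) :=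
      (((hqd' y).mul hu).mul_const (Real.exp (-V y))).derivWithin (hS t ht)
    rw [h, hqd y, heq t ht y]
    simp only [hEdef, hQdef, hFdef, hLFdef]
    ring
  /- Step 2: the two Green identities -/
  -- (G1): against `e^{-F} η²`, with `u = Q`
  have hG1 := integral_mul_cutoffSq_mul_weightedLaplacian hg (a := E) hE hQ hη hηc hV
  have hdE : ∀ y, g.innerDual y (mvfderiv (𝓡 n) E y).toLinearMap (mvfderiv (𝓡 n) Q y).toLinearMap =
      -E y * g.innerDual y (mvfderiv (𝓡 n) F y).toLinearMap (mvfderiv (𝓡 n) Q y).toLinearMap := fun y ↦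
    innerDual_mvfderiv_exp_neg_left (hFd y) _
  -- (G2): against `e^{-F} Q η²`, with `u = F`
  have hEQ : ContMDiff (𝓡 n) 𝓘(ℝ, ℝ) ∞ (fun y ↦ E y * Q y) := hE.mul hQ
  have hG2 := integral_mul_cutoffSq_mul_weightedLaplacian hg (a := fun y ↦ E y * Q y) hEQ hF hη hηc hV
  have hdEQ : ∀ y, g.innerDual y (mvfderiv (𝓡 n) (fun z ↦ E z * Q z) y).toLinearMap
        (mvfderiv (𝓡 n) F y).toLinearMap =
      E y * g.innerDual y (mvfderiv (𝓡 n) Q y).toLinearMap (mvfderiv (𝓡 n) F y).toLinearMap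
        - E y * Q y * Q y := by
    intro y
    rw [innerDual_mvfderiv_mul_left (hEd y) (hQd y), innerDual_mvfderiv_exp_neg_left (hFd y)]
    have : g.innerDual y (mvfderiv (𝓡 n) F y).toLinearMap (mvfderiv (𝓡 n) F y).toLinearMap = Q y := rfl
    rw [this]
    ring
  have hsymQF : ∀ y, g.innerDual y (mvfderiv (𝓡 n) Q y).toLinearMap (mvfderiv (𝓡 n) F y).toLinearMap =
      g.innerDual y (mvfderiv (𝓡 n) F y).toLinearMap (mvfderiv (𝓡 n) Q y).toLinearMap := fun y ↦
    g.innerDual_comm y _ _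
  /- Step 3: continuity, supports, integrability of all the pieces -/
  have hηcont : Continuous η := hη.continuous
  have hη2c : HasCompactSupport (fun y ↦ η y ^ 2) := by
    rw [show (fun y ↦ η y ^ 2) = fun y ↦ η y * η y from funext fun y ↦ sq (η y)]
    exact hηc.mul_right
  have hgradη : Continuous (g.gradSq η) := (contMDiff_gradSq g hη).continuous
  have hgradηs : HasCompactSupport (g.gradSq η) :=
    HasCompactSupport.intro hηc fun y hy ↦ gradSq_eq_zero_of_notMem_tsupport hy
  have hV1 := hV.of_le h1le
  have hIFLF : Continuous fun y ↦ g.innerDual y (mvfderiv (𝓡 n) F y).toLinearMap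
      (mvfderiv (𝓡 n) LF y).toLinearMap := continuous_innerDual_mvfderiv g (hF.of_le h1le) (hLF.of_le h1le)
  have hIFQ : Continuous fun y ↦ g.innerDual y (mvfderiv (𝓡 n) F y).toLinearMap
      (mvfderiv (𝓡 n) Q y).toLinearMap := continuous_innerDual_mvfderiv g (hF.of_le h1le) (hQ.of_le h1le)
  have hIηQ : Continuous fun y ↦ g.innerDual y (mvfderiv (𝓡 n) η y).toLinearMap
      (mvfderiv (𝓡 n) Q y).toLinearMap := continuous_innerDual_mvfderiv g (hη.of_le h1le) (hQ.of_le h1le)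
  have hIηF : Continuous fun y ↦ g.innerDual y (mvfderiv (𝓡 n) η y).toLinearMap
      (mvfderiv (𝓡 n) F y).toLinearMap := continuous_innerDual_mvfderiv g (hη.of_le h1le) (hF.of_le h1le)
  have hLQc : Continuous LQ :=
    (continuous_dalembertian g (hQ.of_le h2le)).sub (continuous_innerDual_mvfderiv g hV1 (hQ.of_le h1le))
  have hSlc : Continuous Sl := ((continuous_const.mul hLQc).sub hIFLF).sub (continuous_const.mul hQ.continuous)
  have hEc : Continuous E := hE.continuous
  have hQc : Continuous Q := hQ.continuous
  have hLFc : Continuous LF := hLF.continuous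
  -- generic integrability of `η² · (continuous)` and `η · (continuous)` products
  have int2 : ∀ {P : M → ℝ}, Continuous P → Integrable (fun y ↦ η y ^ 2 * P y) μ := fun {P} hP ↦
    integrable_of_continuous_of_hasCompactSupport' hg ((hηcont.pow 2).mul hP) (hη2c.mul_right)
  have int1 : ∀ {P : M → ℝ}, Continuous P → Integrable (fun y ↦ η y * P y) μ := fun {P} hP ↦
    integrable_of_continuous_of_hasCompactSupport' hg (hηcont.mul hP) (hηc.mul_right)
  /- Step 4: the left-hand side as `−2K I_η − 2∫η²Sl E e^{-V} − 2∫Eη g(dη,dQ)e^{-V} + 2∫EQη g(dη,dF)e^{-V}` -/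
  -- names for the basic integrals
  set Iη : ℝ := ∫ y, η y ^ 2 * (Q y * E y * Real.exp (-V y)) ∂μ with hIηdef
  set ISl : ℝ := ∫ y, η y ^ 2 * (Sl y * E y * Real.exp (-V y)) ∂μ with hISldef
  set IFQ : ℝ := ∫ y, η y ^ 2 * (g.innerDual y (mvfderiv (𝓡 n) F y).toLinearMap
      (mvfderiv (𝓡 n) Q y).toLinearMap * E y * Real.exp (-V y)) ∂μ with hIFQdef
  set IQLF : ℝ := ∫ y, η y ^ 2 * (Q y * LF y * E y * Real.exp (-V y)) ∂μ with hIQLFdef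
  set IQQ : ℝ := ∫ y, η y ^ 2 * (Q y ^ 2 * E y * Real.exp (-V y)) ∂μ with hIQQdef
  set ILQ : ℝ := ∫ y, η y ^ 2 * (LQ y * E y * Real.exp (-V y)) ∂μ with hILQdef
  set JηQ : ℝ := ∫ y, η y * (E y * g.innerDual y (mvfderiv (𝓡 n) η y).toLinearMap
      (mvfderiv (𝓡 n) Q y).toLinearMap * Real.exp (-V y)) ∂μ with hJηQdef
  set JηF : ℝ := ∫ y, η y * (E y * Q y * g.innerDual y (mvfderiv (𝓡 n) η y).toLinearMap
      (mvfderiv (𝓡 n) F y).toLinearMap * Real.exp (-V y)) ∂μ with hJηFdef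
  -- (i) the left-hand side
  have hLHS : ∫ y, η y ^ 2 * derivWithin (fun s ↦ g.gradSq (φ s) y * Real.exp (-φ s y) * Real.exp (-V y)) S t ∂μ
      = ILQ - 2 * K * Iη - 2 * ISl - 2 * IFQ - IQLF + IQQ := by
    have e1 : ∫ y, η y ^ 2 * derivWithin (fun s ↦ g.gradSq (φ s) y * Real.exp (-φ s y) * Real.exp (-V y)) S t ∂μ
        = ∫ y, (η y ^ 2 * (LQ y * E y * Real.exp (-V y)) - 2 * K * (η y ^ 2 * (Q y * E y * Real.exp (-V y)))
          - 2 * (η y ^ 2 * (Sl y * E y * Real.exp (-V y)))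
          - 2 * (η y ^ 2 * (g.innerDual y (mvfderiv (𝓡 n) F y).toLinearMap
              (mvfderiv (𝓡 n) Q y).toLinearMap * E y * Real.exp (-V y)))
          - η y ^ 2 * (Q y * LF y * E y * Real.exp (-V y))
          + η y ^ 2 * (Q y ^ 2 * E y * Real.exp (-V y))) ∂μ := by
      refine integral_congr_ae (Eventually.of_forall fun y ↦ ?_)
      dsimp only
      rw [hder y]
      simp only [hSldef]
      ring
    rw [e1]
    have i1 : Integrable (fun y ↦ η y ^ 2 * (LQ y * E y * Real.exp (-V y))) μ :=
      int2 (P := fun y ↦ LQ y * E y * Real.exp (-V y)) ((hLQc.mul hEc).mul hW)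
    have i2 : Integrable (fun y ↦ 2 * K * (η y ^ 2 * (Q y * E y * Real.exp (-V y)))) μ :=
      (int2 (P := fun y ↦ Q y * E y * Real.exp (-V y)) ((hQc.mul hEc).mul hW)).const_mul _
    have i3 : Integrable (fun y ↦ 2 * (η y ^ 2 * (Sl y * E y * Real.exp (-V y)))) μ :=
      (int2 (P := fun y ↦ Sl y * E y * Real.exp (-V y)) ((hSlc.mul hEc).mul hW)).const_mul _
    have i4 : Integrable (fun y ↦ 2 * (η y ^ 2 * (g.innerDual y (mvfderiv (𝓡 n) F y).toLinearMap
        (mvfderiv (𝓡 n) Q y).toLinearMap * E y * Real.exp (-V y)))) μ :=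
      (int2 (P := fun y ↦ g.innerDual y (mvfderiv (𝓡 n) F y).toLinearMap
        (mvfderiv (𝓡 n) Q y).toLinearMap * E y * Real.exp (-V y)) ((hIFQ.mul hEc).mul hW)).const_mul _
    have i5 : Integrable (fun y ↦ η y ^ 2 * (Q y * LF y * E y * Real.exp (-V y))) μ :=
      int2 (P := fun y ↦ Q y * LF y * E y * Real.exp (-V y)) (((hQc.mul hLFc).mul hEc).mul hW)
    have i6 : Integrable (fun y ↦ η y ^ 2 * (Q y ^ 2 * E y * Real.exp (-V y))) μ :=
      int2 (P := fun y ↦ Q y ^ 2 * E y * Real.exp (-V y)) (((hQc.pow 2).mul hEc).mul hW)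
    have i12 : Integrable (fun y ↦ η y ^ 2 * (LQ y * E y * Real.exp (-V y))
        - 2 * K * (η y ^ 2 * (Q y * E y * Real.exp (-V y)))) μ := i1.sub i2
    have i123 : Integrable (fun y ↦ η y ^ 2 * (LQ y * E y * Real.exp (-V y))
        - 2 * K * (η y ^ 2 * (Q y * E y * Real.exp (-V y)))
        - 2 * (η y ^ 2 * (Sl y * E y * Real.exp (-V y)))) μ := i12.sub i3
    have i1234 : Integrable (fun y ↦ η y ^ 2 * (LQ y * E y * Real.exp (-V y))
        - 2 * K * (η y ^ 2 * (Q y * E y * Real.exp (-V y)))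
        - 2 * (η y ^ 2 * (Sl y * E y * Real.exp (-V y)))
        - 2 * (η y ^ 2 * (g.innerDual y (mvfderiv (𝓡 n) F y).toLinearMap
            (mvfderiv (𝓡 n) Q y).toLinearMap * E y * Real.exp (-V y)))) μ := i123.sub i4
    have i12345 : Integrable (fun y ↦ η y ^ 2 * (LQ y * E y * Real.exp (-V y))
        - 2 * K * (η y ^ 2 * (Q y * E y * Real.exp (-V y)))
        - 2 * (η y ^ 2 * (Sl y * E y * Real.exp (-V y)))
        - 2 * (η y ^ 2 * (g.innerDual y (mvfderiv (𝓡 n) F y).toLinearMap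
            (mvfderiv (𝓡 n) Q y).toLinearMap * E y * Real.exp (-V y)))
        - η y ^ 2 * (Q y * LF y * E y * Real.exp (-V y))) μ := i1234.sub i5
    rw [integral_add i12345 i6, integral_sub i1234 i5, integral_sub i123 i4, integral_sub i12 i3,
      integral_sub i1 i2, integral_const_mul, integral_const_mul, integral_const_mul]
  -- (ii) Green (G1): `ILQ = IFQ - 2 JηQ`
  have hILQ : ILQ = IFQ - 2 * JηQ := by
    have e0 : ILQ = ∫ y, E y * η y ^ 2 * (g.dalembertian Q y
        - g.innerDual y (mvfderiv (𝓡 n) V y).toLinearMap (mvfderiv (𝓡 n) Q y).toLinearMap) *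
        Real.exp (-V y) ∂μ := integral_congr_ae (Eventually.of_forall fun y ↦ by simp only [hLQdef]; ring)
    have e1 : -(∫ y, η y ^ 2 * g.innerDual y (mvfderiv (𝓡 n) E y).toLinearMap
          (mvfderiv (𝓡 n) Q y).toLinearMap * Real.exp (-V y) ∂μ) = IFQ := by
      rw [← integral_neg]
      refine integral_congr_ae (Eventually.of_forall fun y ↦ ?_)
      dsimp only
      rw [hdE y]; ring
    have e2 : ∫ y, E y * η y * g.innerDual y (mvfderiv (𝓡 n) η y).toLinearMap
        (mvfderiv (𝓡 n) Q y).toLinearMap * Real.exp (-V y) ∂μ = JηQ :=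
      integral_congr_ae (Eventually.of_forall fun y ↦ by ring)
    rw [e0, hG1, e1, e2]
  -- (iii) Green (G2): `IQLF = -(IFQ - IQQ) - 2 JηF`
  have hIQLF : IQLF = -(IFQ - IQQ) - 2 * JηF := by
    have e0 : IQLF = ∫ y, (E y * Q y) * η y ^ 2 * (g.dalembertian F y
        - g.innerDual y (mvfderiv (𝓡 n) V y).toLinearMap (mvfderiv (𝓡 n) F y).toLinearMap) *
        Real.exp (-V y) ∂μ := integral_congr_ae (Eventually.of_forall fun y ↦ by simp only [hLFdef]; ring)
    have iP : Integrable (fun y ↦ η y ^ 2 * (g.innerDual y (mvfderiv (𝓡 n) F y).toLinearMap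
        (mvfderiv (𝓡 n) Q y).toLinearMap * E y * Real.exp (-V y))) μ :=
      int2 (P := fun y ↦ g.innerDual y (mvfderiv (𝓡 n) F y).toLinearMap
        (mvfderiv (𝓡 n) Q y).toLinearMap * E y * Real.exp (-V y)) ((hIFQ.mul hEc).mul hW)
    have iQ2 : Integrable (fun y ↦ η y ^ 2 * (Q y ^ 2 * E y * Real.exp (-V y))) μ :=
      int2 (P := fun y ↦ Q y ^ 2 * E y * Real.exp (-V y)) (((hQc.pow 2).mul hEc).mul hW)
    have e1 : ∫ y, η y ^ 2 * g.innerDual y (mvfderiv (𝓡 n) (fun z ↦ E z * Q z) y).toLinearMap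
          (mvfderiv (𝓡 n) F y).toLinearMap * Real.exp (-V y) ∂μ = IFQ - IQQ := by
      rw [hIFQdef, hIQQdef, ← integral_sub iP iQ2]
      refine integral_congr_ae (Eventually.of_forall fun y ↦ ?_)
      dsimp only
      rw [hdEQ y, hsymQF y]; ring
    have e2 : ∫ y, E y * Q y * η y * g.innerDual y (mvfderiv (𝓡 n) η y).toLinearMap
        (mvfderiv (𝓡 n) F y).toLinearMap * Real.exp (-V y) ∂μ = JηF :=
      integral_congr_ae (Eventually.of_forall fun y ↦ by ring)
    rw [e0, hG2, e1, e2]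
  /- Step 5: the remainder is bounded pointwise -/
  have hrem : -2 * ISl - 2 * JηQ + 2 * JηF ≤ (2 * δ ^ 2 + 2 * δ * L₀) *
      ∫ y, g.gradSq (φ t) y * Real.exp (-φ t y) * Real.exp (-V y) ∂μ := by
    have j1 : Integrable (fun y ↦ -2 * (η y ^ 2 * (Sl y * E y * Real.exp (-V y)))) μ :=
      (int2 (P := fun y ↦ Sl y * E y * Real.exp (-V y)) ((hSlc.mul hEc).mul hW)).const_mul _
    have j2 : Integrable (fun y ↦ 2 * (η y * (E y * g.innerDual y (mvfderiv (𝓡 n) η y).toLinearMap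
        (mvfderiv (𝓡 n) Q y).toLinearMap * Real.exp (-V y)))) μ :=
      (int1 (P := fun y ↦ E y * g.innerDual y (mvfderiv (𝓡 n) η y).toLinearMap
        (mvfderiv (𝓡 n) Q y).toLinearMap * Real.exp (-V y)) ((hEc.mul hIηQ).mul hW)).const_mul _
    have j3 : Integrable (fun y ↦ 2 * (η y * (E y * Q y * g.innerDual y (mvfderiv (𝓡 n) η y).toLinearMap
        (mvfderiv (𝓡 n) F y).toLinearMap * Real.exp (-V y)))) μ :=
      (int1 (P := fun y ↦ E y * Q y * g.innerDual y (mvfderiv (𝓡 n) η y).toLinearMap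
        (mvfderiv (𝓡 n) F y).toLinearMap * Real.exp (-V y)) (((hEc.mul hQc).mul hIηF).mul hW)).const_mul _
    have j12 : Integrable (fun y ↦ -2 * (η y ^ 2 * (Sl y * E y * Real.exp (-V y)))
        - 2 * (η y * (E y * g.innerDual y (mvfderiv (𝓡 n) η y).toLinearMap
            (mvfderiv (𝓡 n) Q y).toLinearMap * Real.exp (-V y)))) μ := j1.sub j2
    have iL : Integrable (fun y ↦ -2 * (η y ^ 2 * (Sl y * E y * Real.exp (-V y)))
        - 2 * (η y * (E y * g.innerDual y (mvfderiv (𝓡 n) η y).toLinearMap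
            (mvfderiv (𝓡 n) Q y).toLinearMap * Real.exp (-V y)))
        + 2 * (η y * (E y * Q y * g.innerDual y (mvfderiv (𝓡 n) η y).toLinearMap
            (mvfderiv (𝓡 n) F y).toLinearMap * Real.exp (-V y)))) μ := j12.add j3
    have iR : Integrable (fun y ↦ (2 * δ ^ 2 + 2 * δ * L₀) *
        (g.gradSq (φ t) y * Real.exp (-φ t y) * Real.exp (-V y))) μ := hint.const_mul _
    have hmono := integral_mono iL iR fun y ↦ ?_
    · rw [integral_add j12 j3, integral_sub j1 j2, integral_const_mul, integral_const_mul, integral_const_mul,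
        integral_const_mul] at hmono
      exact hmono
    -- the pointwise bound at `y`
    have hEy := hE0 y
    have hWy : 0 ≤ Real.exp (-V y) := (Real.exp_pos _).le
    have hQ0 : 0 ≤ Q y := g.gradSq_nonneg hg F y
    have hGη0 : 0 ≤ g.gradSq η y := g.gradSq_nonneg hg η y
    set J := g.innerDual y (mvfderiv (𝓡 n) η y).toLinearMap (mvfderiv (𝓡 n) Q y).toLinearMap with hJ
    set I' := g.innerDual y (mvfderiv (𝓡 n) η y).toLinearMap (mvfderiv (𝓡 n) F y).toLinearMap with hI'
    -- the Hessian error absorbed into the slack: `-2 η J - 2 η² Sl ≤ 2 |∇η|² Q`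
    have ha := slack_absorb (ψ' := 1) (e := 1) (η := η y) zero_le_one zero_le_one (hSl0 y) hGη0 hQ0 (hslack y)
    have ha' : -(2 * (η y * J)) - 2 * (η y ^ 2 * Sl y) ≤ 2 * (g.gradSq η y * Q y) := by
      simpa only [one_mul, mul_one] using ha
    have hG1' : 2 * (g.gradSq η y * Q y) ≤ 2 * δ ^ 2 * Q y := by
      have h := mul_le_mul_of_nonneg_right (hηgrad y) hQ0
      linarith only [h]
    -- the cubic term: `2 η Q I' ≤ 2 δ L₀ Q`
    have hI'abs : |I'| ≤ δ * L₀ := by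
      have h1 := abs_innerDual_le_sqrt_gradSq_mul hg η F y
      have h2 : Real.sqrt (g.gradSq η y) ≤ δ := by
        rw [← Real.sqrt_sq hδ]; exact Real.sqrt_le_sqrt (hηgrad y)
      have h3 : Real.sqrt (g.gradSq F y) ≤ L₀ := by
        rw [← Real.sqrt_sq hL₀]; exact Real.sqrt_le_sqrt (hφgrad y)
      exact h1.trans (mul_le_mul h2 h3 (Real.sqrt_nonneg _) hδ)
    have hcubic : 2 * (η y * (Q y * I')) ≤ 2 * δ * L₀ * Q y := by
      have h1 : η y * (Q y * I') ≤ |η y * (Q y * I')| := le_abs_self _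
      have h2 : |η y * (Q y * I')| = |η y| * (Q y * |I'|) := by rw [abs_mul, abs_mul, abs_of_nonneg hQ0]
      have h3 : |η y| * (Q y * |I'|) ≤ 1 * (Q y * (δ * L₀)) :=
        mul_le_mul (hη1 y) (mul_le_mul_of_nonneg_left hI'abs hQ0) (mul_nonneg hQ0 (abs_nonneg _)) zero_le_one
      linarith only [h1, h2, h3]
    have hEW : 0 ≤ E y * Real.exp (-V y) := mul_nonneg hEy hWy
    have key := mul_le_mul_of_nonneg_right (add_le_add (ha'.trans hG1') hcubic) hEW
    have eφ : g.gradSq (φ t) y * Real.exp (-φ t y) * Real.exp (-V y) = Q y * (E y * Real.exp (-V y)) := by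
      simp only [hQdef, hEdef, hFdef]; ring
    rw [eφ]
    calc -2 * (η y ^ 2 * (Sl y * E y * Real.exp (-V y)))
          - 2 * (η y * (E y * J * Real.exp (-V y))) + 2 * (η y * (E y * Q y * I' * Real.exp (-V y)))
        = (-(2 * (η y * J)) - 2 * (η y ^ 2 * Sl y) + 2 * (η y * (Q y * I'))) * (E y * Real.exp (-V y)) := by
          ring
      _ ≤ (2 * δ ^ 2 * Q y + 2 * δ * L₀ * Q y) * (E y * Real.exp (-V y)) := key
      _ = (2 * δ ^ 2 + 2 * δ * L₀) * (Q y * (E y * Real.exp (-V y))) := by ring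
  /- Step 6: conclusion -/
  have hrem' : -2 * ISl - 2 * JηQ + 2 * JηF ≤ (2 * δ ^ 2 + 2 * δ * L₀) *
      ∫ y, Q y * Real.exp (-F y) * Real.exp (-V y) ∂μ := hrem
  rw [hLHS, hILQ, hIQLF]
  linarith only [hrem']

end Fisher

end Literature.Geometry.Riemannian.BakryEmeryComplete

end Part4

/-!
## Part 5 — port of `Summits/SmoothPoincare4/SmoothPoincare4/Theorems/EntropyRungNoncompactShrinkerGapHeatDissipationCutoff.lean` (1 declarations kept)

# The Bakry–Émery entropy inequality with ONE cut-off along the weighted heat flow on a complete manifold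

Helper of the registered stub `stub_compactSupportLSI`. Setting: `(M, g)` modelled on `ℝⁿ` (NOT compact),
`Ric + Hess V ≥ K g` with `K > 0`, `L = Δ − g⁻¹(dV, d·)`, a positive solution `ρ` of `∂ₜρ = Lρ` on `[0, T]` (smooth on
`M × O`, `O ⊇ [0,T]` open) with `c ≤ ρ ≤ C'` and `|∇ρ|² ≤ G`, and a smooth compactly supported cut-off `0 ≤ η`.
With `A(t) = ∫ η |∇ρ|²/ρ e^{-V}` (cut-off Fisher information) and `B(t) = ∫ η ρ log ρ e^{-V}` (cut-off entropy):

  `B(0) − B(T) ≤ (1/2K) A(0) + T · (C' Λ + G/(2Kc)) · ∫ |Lη| e^{-V}`,  `Λ = max(|log c|, |log C'|)`   (`cutoffEntropy_le`).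

Proof: `A` and `B` are continuous on `[0,T]` and differentiable on `(0,T)` (differentiation under the integral sign
against the compactly supported weight `η e^{-V}`), with `A' ≤ −2K A + R` (`fisherCutoff_le`) and `B' = −A + S`
(`entropyCutoff_eq`), where the boundary terms satisfy `|R| ≤ (G/c) ∫|Lη|e^{-V}`, `|S| ≤ C'Λ ∫|Lη|e^{-V}`; hence
`Θ = B − A/2K + e·t` is monotone (`monotoneOn_of_deriv_nonneg`), which is the claim since `A(T) ≥ 0`.
No Grönwall lemma and no integral in time is needed. Everything is proved; no definitions.
-/

section Part5

open scoped _root_.Manifold _root_.ContDiff _root_.ENNReal _root_.NNReal _root_.Topology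
open _root_.MeasureTheory _root_.Set _root_.Filter
open Literature.Geometry.Lorentzian Literature.Geometry.Riemannian

namespace Literature.Geometry.Riemannian.NoncompactShrinkerGapHeat

section OneCutoff

variable {n : ℕ} {M : Type*} [TopologicalSpace M] [T2Space M] [SecondCountableTopology M]
  [ChartedSpace (EuclideanSpace ℝ (Fin n)) M] [IsManifold (𝓡 n) ∞ M] [T3Space M] [MeasurableSpace M]
  [BorelSpace M]
  {g : PseudoRiemannianMetric (𝓡 n) ∞ (EuclideanSpace ℝ (Fin n)) (TangentSpace (𝓡 n) : M → Type _)}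
  [g.HasLeviCivita]

omit [T2Space M] [SecondCountableTopology M] [T3Space M] [MeasurableSpace M] [BorelSpace M] [g.HasLeviCivita] in
/-- `|∇(−log ρ)|² e^{log ρ} = |∇ρ|²/ρ` at a point where `ρ > 0`. [cite: CarrilloNi2009, §3 (3.2)–(3.4) and p. 8] -/
theorem gradSq_negLog_mul_exp {ρ : M → ℝ} {x : M} (hρ : MDifferentiableAt (𝓡 n) 𝓘(ℝ, ℝ) ρ x) (hpos : 0 < ρ x) :
    g.gradSq (fun y ↦ -Real.log (ρ y)) x * Real.exp (-(-Real.log (ρ x))) = g.gradSq ρ x / ρ x := by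
  have hd : HasDerivAt (fun s : ℝ ↦ -Real.log s) (-(ρ x)⁻¹) (ρ x) := (Real.hasDerivAt_log hpos.ne').neg
  have h := g.gradSq_real_comp (h := fun s : ℝ ↦ -Real.log s) hd hρ
  rw [show (fun y ↦ -Real.log (ρ y)) = (fun s : ℝ ↦ -Real.log s) ∘ ρ from rfl, h, neg_neg,
    Real.exp_log hpos]
  field_simp

end OneCutoff

end Literature.Geometry.Riemannian.NoncompactShrinkerGapHeat

end Part5

/-!
## Part 6 — port of `Summits/SmoothPoincare4/SmoothPoincare4/Theorems/EntropyRungBakryEmeryLogSobolevFisherDecay.lean` (1 declarations kept)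

# Exponential decay of the Fisher information along the weighted heat flow on a complete
# `CD(K, ∞)` manifold, with first-order (Gaffney) cut-offs

Setting: `M` modelled on `ℝⁿ` (Hausdorff, second countable, `T₃`, Borel — NOT compact), `g`
Riemannian with its Levi-Civita connection, `V` smooth with `Ric + Hess V ≥ K g` and `e^{-V} ∈ L¹`
(NO other assumption on `V`), `L = Δ_g − g⁻¹(dV, d·)`; Gaffney cut-offs `η_k ∈ C_c^∞`, `0 ≤ η_k ≤ 1`,
`η_k(x) = 1` for large `k`, `|∇η_k|² ≤ C₀/(k+1)²`.

**Theorem** (`gaffney_fisherDecay`). Let `u` be smooth on `M × O` (`O ⊇ [0, T]` open) with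
`∂ₛu = Lu` on `[0, T]`, `a ≤ u ≤ b` (`a > 0`) and `|∇u|² ≤ C_G` on `[0, T] × M` (the a priori bounds of
`gaffney_maxPrinciple` and `gaffney_gradientDecay`). Then the Fisher information
`I(t) = ∫ |∇u(t)|²/u(t) e^{-V} dV_g` satisfies `I(t) ≤ e^{-2Kt} I(0)` for `t ∈ [0, T]`.

Proof (Bakry–Émery 1985; BGL 2014, Prop. 5.7.1; Carrillo–Ni 2009, §3): with `φ = −log u`
(`negLog_heat_equation`: `∂ₜφ = Lφ − |∇φ|²` within `[0, T]`), `|∇φ|²e^{-φ} = |∇u|²/u`, and the cut-off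
Fisher informations `A_k(t) = ∫ η_k² |∇φ|² e^{-φ} e^{-V}`, the first-order dissipation inequality
`fisher_cutoffSq_le` gives `A_k' ≤ −2K A_k + ε_k J`, `ε_k = 2δ_k² + 2δ_k L₀ → 0` (`δ_k² = C₀/(k+1)²`,
`L₀² = C_G/a²`, `J ≤ (C_G/a) ∫e^{-V}`), so `t ↦ e^{2Kt}A_k(t) − t e^{2|K|T} ε_k J_max` is non-increasing on
`[0, T]`; letting `k → ∞` (dominated convergence) yields `e^{2Kt} I(t) ≤ I(0)`. Everything is proved; no
definitions, no named facts.

## References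

* [BakryGentilLedoux2014] D. Bakry, I. Gentil, M. Ledoux (2014), Prop. 5.7.1 (p. 268), §3.2 (pp. 141–147).
* [BakryEmery1985] D. Bakry, M. Émery, LNM 1123 (1985) 177–206.
* [CarrilloNi2009] J. A. Carrillo, L. Ni, Comm. Anal. Geom. 17 (2009), §3 (3.2)–(3.4), p. 8.
-/

section Part6

open scoped _root_.Manifold _root_.ContDiff _root_.ENNReal _root_.NNReal _root_.Topology
open _root_.MeasureTheory _root_.Set _root_.Filter
open Literature.Geometry.Lorentzian Literature.Geometry.Riemannian

namespace Literature.Geometry.Riemannian.BakryEmeryComplete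

open NoncompactShrinkerGapHeat NoncompactShrinkerGapHeat.CutoffToolkit

section FisherDecay

variable {n : ℕ} {M : Type*} [TopologicalSpace M] [T2Space M] [SecondCountableTopology M]
  [ChartedSpace (EuclideanSpace ℝ (Fin n)) M] [IsManifold (𝓡 n) ∞ M] [T3Space M]
  [MeasurableSpace M] [BorelSpace M]
  {g : PseudoRiemannianMetric (𝓡 n) ∞ (EuclideanSpace ℝ (Fin n)) (TangentSpace (𝓡 n) : M → Type _)}
  [g.HasLeviCivita]

/-- **Exponential decay of the Fisher information along the weighted heat flow on a complete
`CD(K,∞)` manifold** (see the module docstring): for `u` smooth on `M × O`, `∂ₛu = Lu` on `[0,T]`,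
`0 < a ≤ u ≤ b`, `|∇u|² ≤ C_G` on `[0,T] × M`, `e^{-V} ∈ L¹`, and Gaffney cut-offs,
`∫ |∇u(t)|²/u(t) e^{-V} ≤ e^{-2Kt} ∫ |∇u(0)|²/u(0) e^{-V}` for `t ∈ [0, T]`.
[cite: BakryGentilLedoux2014, Prop. 5.7.1 (p. 268)] [cite: BakryEmery1985]
[cite: CarrilloNi2009, §3 (3.2)–(3.4), p. 8] -/
theorem gaffney_fisherDecay (hg : g.IsRiemannian) {V : M → ℝ} {K : ℝ}
    (hV : ContMDiff (𝓡 n) 𝓘(ℝ, ℝ) ∞ V)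
    (hRic : ∀ (y : M) (X : TangentSpace (𝓡 n) y), K * g.val y X X ≤ g.ricci y X X + g.hessian V y X X)
    (hw : Integrable (fun y ↦ Real.exp (-V y)) g.riemVolume)
    {η : ℕ → M → ℝ} {C₀ : ℝ} (hηs : ∀ k, ContMDiff (𝓡 n) 𝓘(ℝ, ℝ) ∞ (η k))
    (hηc : ∀ k, HasCompactSupport (η k)) (hη01 : ∀ k x, 0 ≤ η k x ∧ η k x ≤ 1)
    (hη1 : ∀ x, ∀ᶠ k in atTop, η k x = 1)
    (hηgrad : ∀ k x, g.gradSq (η k) x ≤ C₀ / ((k : ℝ) + 1) ^ 2)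
    {T : ℝ} {O : Set ℝ} {u : ℝ → M → ℝ} (hT : 0 < T) (hO : IsOpen O) (hTO : Icc 0 T ⊆ O)
    (hu : ContMDiffOn ((𝓡 n).prod 𝓘(ℝ, ℝ)) 𝓘(ℝ, ℝ) ∞ (fun p : M × ℝ ↦ u p.2 p.1) (univ ×ˢ O))
    (heq : ∀ s ∈ Icc 0 T, ∀ x, deriv (fun r ↦ u r x) s = g.dalembertian (u s) x
      - g.innerDual x (mvfderiv (𝓡 n) V x).toLinearMap (mvfderiv (𝓡 n) (u s) x).toLinearMap)
    {a b CG : ℝ} (ha : 0 < a) (hab : ∀ s ∈ Icc 0 T, ∀ x, a ≤ u s x ∧ u s x ≤ b)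
    (hG : ∀ s ∈ Icc 0 T, ∀ x, g.gradSq (u s) x ≤ CG) :
    ∀ t ∈ Icc 0 T, ∫ y, g.gradSq (u t) y / u t y * Real.exp (-V y) ∂g.riemVolume ≤
      Real.exp (-2 * K * t) * ∫ y, g.gradSq (u 0) y / u 0 y * Real.exp (-V y) ∂g.riemVolume := by
  intro t₀ ht₀
  haveI := CarrilloNi2009_shrinkerLSI.isFiniteMeasureOnCompacts_riemVolume hg
  set μ : Measure M := g.riemVolume with hμ
  -- the time set `S = [0, T]`
  set S : Set ℝ := Icc 0 T with hSdef
  have hS : UniqueDiffOn ℝ S := uniqueDiffOn_Icc hT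
  have hS' : S ⊆ closure (interior S) := by rw [hSdef, interior_Icc, closure_Ioo hT.ne]
  have huS : ContMDiffOn ((𝓡 n).prod 𝓘(ℝ, ℝ)) 𝓘(ℝ, ℝ) ∞ (fun p : M × ℝ ↦ u p.2 p.1) (univ ×ˢ S) :=
    hu.mono (prod_mono le_rfl hTO)
  have hpos : ∀ t ∈ S, ∀ y, 0 < u t y := fun t ht y ↦ ha.trans_le (hab t ht y).1
  have hslice : ∀ t ∈ S, ContMDiff (𝓡 n) 𝓘(ℝ, ℝ) ∞ (u t) := fun t ht ↦
    huS.comp_contMDiff (contMDiff_id.prodMk contMDiff_const) fun y ↦ ⟨mem_univ _, ht⟩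
  -- the equation within `S`, and the equation of `φ = −log u`
  have hdS : ∀ t ∈ S, ∀ y, HasDerivAt (fun r ↦ u r y) (deriv (fun r ↦ u r y) t) t := fun t ht y ↦
    hasDerivAt_slice_of_contMDiffOn hO (v := fun p : M × ℝ ↦ u p.2 p.1) hu y (hTO ht)
  have heqS : ∀ t ∈ S, ∀ y, derivWithin (fun r ↦ u r y) S t = g.dalembertian (u t) y
      - g.innerDual y (mvfderiv (𝓡 n) V y).toLinearMap (mvfderiv (𝓡 n) (u t) y).toLinearMap := by
    intro t ht y
    rw [(hdS t ht y).differentiableAt.derivWithin (hS t ht)]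
    exact heq t ht y
  set φ : ℝ → M → ℝ := fun t y ↦ -Real.log (u t y) with hφdef
  have hφ : ContMDiffOn ((𝓡 n).prod 𝓘(ℝ, ℝ)) 𝓘(ℝ, ℝ) ∞ (fun p : M × ℝ ↦ φ p.2 p.1) (univ ×ˢ S) := by
    intro p hp
    have hne : u p.2 p.1 ≠ 0 := (hpos p.2 hp.2 p.1).ne'
    exact ((Real.contDiffAt_log.2 hne).comp_contMDiffWithinAt (f := fun p : M × ℝ ↦ u p.2 p.1) (x := p)
      (huS p hp)).neg
  have heqφ : ∀ t ∈ S, ∀ y : M, derivWithin (fun s ↦ φ s y) S t =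
      g.dalembertian (φ t) y
        - g.innerDual y (mvfderiv (𝓡 n) V y).toLinearMap (mvfderiv (𝓡 n) (φ t) y).toLinearMap
        - g.gradSq (φ t) y := by
    intro t ht y
    have hut : ContMDiffAt (𝓡 n) 𝓘(ℝ, ℝ) 2 (u t) y :=
      ((hslice t ht).of_le (WithTop.coe_le_coe.mpr le_top)).contMDiffAt
    have hd : HasDerivWithinAt (fun s ↦ u s y) (derivWithin (fun s ↦ u s y) S t) S t :=
      hasDerivWithinAt_time_of_contMDiffOn (by simp) huS y ht
    exact negLog_heat_equation g hut (hpos t ht y) hd (hS t ht) (heqS t ht y)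
  have hφslice : ∀ t ∈ S, ContMDiff (𝓡 n) 𝓘(ℝ, ℝ) ∞ (φ t) := fun t ht ↦
    hφ.comp_contMDiff (contMDiff_id.prodMk contMDiff_const) fun y ↦ ⟨mem_univ _, ht⟩
  -- the Fisher integrand `F(t, y) = |∇φ|² e^{-φ} e^{-V} = |∇u|²/u e^{-V}`, jointly smooth on `M × S`
  have hFfam : ContMDiffOn ((𝓡 n).prod 𝓘(ℝ, ℝ)) 𝓘(ℝ, ℝ) ∞ (fun p : M × ℝ ↦
      g.gradSq (φ p.2) p.1 * Real.exp (-φ p.2 p.1) * Real.exp (-V p.1)) (univ ×ˢ S) := by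
    have hq := contMDiffOn_gradSq_family g hS (f := φ) hφ
    have he : ContMDiffOn ((𝓡 n).prod 𝓘(ℝ, ℝ)) 𝓘(ℝ, ℝ) ∞ (fun p : M × ℝ ↦ Real.exp (-φ p.2 p.1))
        (univ ×ˢ S) := (Real.contDiff_exp.comp contDiff_neg).contMDiff.comp_contMDiffOn hφ
    have hwf : ContMDiffOn ((𝓡 n).prod 𝓘(ℝ, ℝ)) 𝓘(ℝ, ℝ) ∞ (fun p : M × ℝ ↦ Real.exp (-V p.1)) (univ ×ˢ S) :=
      ((Real.contDiff_exp.comp contDiff_neg).comp_contMDiff (hV.comp contMDiff_fst)).contMDiffOn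
    exact (hq.mul he).mul hwf
  have hF'fam := contMDiffOn_derivWithin_time_of_uniqueDiffOn (u := fun t y ↦
      g.gradSq (φ t) y * Real.exp (-φ t y) * Real.exp (-V y)) hS hFfam
  have hFu : ∀ t ∈ S, ∀ y, g.gradSq (φ t) y * Real.exp (-φ t y) = g.gradSq (u t) y / u t y := fun t ht y ↦
    gradSq_negLog_mul_exp ((hslice t ht).mdifferentiableAt (by simp)) (hpos t ht y)
  -- constants
  have hCG0 : ∀ y : M, 0 ≤ CG := fun y ↦ (g.gradSq_nonneg hg _ y).trans (hG 0 ⟨le_rfl, hT.le⟩ y)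
  have hC₀ : ∀ y : M, 0 ≤ C₀ := fun y ↦ by
    have h1 := hηgrad 0 y
    have h2 : 0 ≤ g.gradSq (η 0) y := g.gradSq_nonneg hg _ _
    rcases div_nonneg_iff.1 (h2.trans h1) with h | h
    · exact h.1
    · exact absurd h.2 (not_le.mpr (by positivity))
  -- the pointwise bounds: `0 ≤ F ≤ (C_G/a) e^{-V}`, `|∇φ|² ≤ C_G/a²`
  have hFbd : ∀ t ∈ S, ∀ y, 0 ≤ g.gradSq (φ t) y * Real.exp (-φ t y) ∧
      g.gradSq (φ t) y * Real.exp (-φ t y) ≤ CG / a := by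
    intro t ht y
    rw [hFu t ht y]
    have hρy := hab t ht y
    have hGy := hG t ht y
    have hQ0 : 0 ≤ g.gradSq (u t) y := g.gradSq_nonneg hg _ _
    have hρpos := hpos t ht y
    refine ⟨div_nonneg hQ0 hρpos.le, ?_⟩
    rw [div_le_div_iff₀ hρpos ha]
    nlinarith
  have hgradφ : ∀ t ∈ S, ∀ y, g.gradSq (φ t) y ≤ (Real.sqrt CG / a) ^ 2 := by
    intro t ht y
    have h := hFu t ht y
    have hρpos := hpos t ht y
    have hex : Real.exp (-φ t y) = u t y := by simp only [hφdef, neg_neg, Real.exp_log hρpos]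
    rw [hex] at h
    have h2 : g.gradSq (φ t) y = g.gradSq (u t) y / u t y ^ 2 := by
      field_simp at h ⊢
      linarith [h]
    rw [h2, div_pow, Real.sq_sqrt (hCG0 y), div_le_div_iff₀ (pow_pos hρpos 2) (pow_pos ha 2)]
    have h3 := hG t ht y
    have h4 : a ^ 2 ≤ u t y ^ 2 := pow_le_pow_left₀ ha.le (hab t ht y).1 2
    nlinarith [g.gradSq_nonneg hg (u t) y]
  -- the full Fisher information `J`, bounded by `J_max`
  have hWc : Continuous fun y ↦ Real.exp (-V y) := Real.continuous_exp.comp hV.continuous.neg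
  have hFc : ∀ t ∈ S, Continuous fun y ↦ g.gradSq (φ t) y * Real.exp (-φ t y) * Real.exp (-V y) := fun t ht ↦
    (hFfam.continuousOn.comp_continuous (continuous_id.prodMk continuous_const) fun y ↦ ⟨mem_univ _, ht⟩ :)
  have hFint : ∀ t ∈ S, Integrable (fun y ↦ g.gradSq (φ t) y * Real.exp (-φ t y) * Real.exp (-V y)) μ := by
    intro t ht
    refine (hw.const_mul (CG / a)).mono' (hFc t ht).aestronglyMeasurable (Eventually.of_forall fun y ↦ ?_)
    rw [Real.norm_eq_abs, abs_of_nonneg (mul_nonneg (hFbd t ht y).1 (Real.exp_pos _).le)]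
    exact mul_le_mul_of_nonneg_right (hFbd t ht y).2 (Real.exp_pos _).le
  set J : ℝ → ℝ := fun t ↦ ∫ y, g.gradSq (φ t) y * Real.exp (-φ t y) * Real.exp (-V y) ∂μ with hJdef
  set Jmax : ℝ := CG / a * ∫ y, Real.exp (-V y) ∂μ with hJmax
  have hJ0 : ∀ t ∈ S, 0 ≤ J t := fun t ht ↦ integral_nonneg fun y ↦ mul_nonneg (hFbd t ht y).1 (Real.exp_pos _).le
  have hJle : ∀ t ∈ S, J t ≤ Jmax := by
    intro t ht
    calc J t ≤ ∫ y, CG / a * Real.exp (-V y) ∂μ :=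
          integral_mono (hFint t ht) (hw.const_mul _) fun y ↦
            mul_le_mul_of_nonneg_right (hFbd t ht y).2 (Real.exp_pos _).le
      _ = Jmax := integral_const_mul _ _
  have hJmax0 : 0 ≤ Jmax := (hJ0 0 ⟨le_rfl, hT.le⟩).trans (hJle 0 ⟨le_rfl, hT.le⟩)
  -- the cut-off Fisher informations `A k`, their derivatives `DA k`, the error sizes `ε k`
  set A : ℕ → ℝ → ℝ := fun k t ↦ ∫ y, η k y ^ 2 * (g.gradSq (φ t) y * Real.exp (-φ t y) * Real.exp (-V y)) ∂μ
    with hAdef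
  set DA : ℕ → ℝ → ℝ := fun k t ↦ ∫ y, η k y ^ 2 * derivWithin (fun s ↦ g.gradSq (φ s) y *
      Real.exp (-φ s y) * Real.exp (-V y)) S t ∂μ with hDAdef
  set δ : ℕ → ℝ := fun k ↦ Real.sqrt C₀ / ((k : ℝ) + 1) with hδdef
  set L₀ : ℝ := Real.sqrt CG / a with hL₀
  have hL₀0 : 0 ≤ L₀ := div_nonneg (Real.sqrt_nonneg _) ha.le
  have hδ0 : ∀ k, 0 ≤ δ k := fun k ↦ div_nonneg (Real.sqrt_nonneg _) (by positivity)
  have hδgrad : ∀ k y, g.gradSq (η k) y ≤ δ k ^ 2 := fun k y ↦ by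
    simp only [hδdef]
    rw [div_pow, Real.sq_sqrt (hC₀ y)]
    exact hηgrad k y
  set ε : ℕ → ℝ := fun k ↦ 2 * δ k ^ 2 + 2 * δ k * L₀ with hεdef
  have hε0 : ∀ k, 0 ≤ ε k := fun k ↦ by positivity
  have hηabs : ∀ k y, |η k y| ≤ 1 := fun k y ↦ abs_le.2 ⟨by linarith [(hη01 k y).1], (hη01 k y).2⟩
  -- (f1) the dissipation inequality
  have f1 : ∀ k, ∀ t ∈ S, DA k t ≤ -2 * K * A k t + ε k * J t := fun k t ht ↦
    fisher_cutoffSq_le hg hV hRic hS hS' hφ heqφ (hηs k) (hηc k) (hηabs k) (hδ0 k) (hδgrad k) ht hL₀0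
      (hgradφ t ht) (hFint t ht)
  -- (f6), (f7): continuity on `S`, differentiability on the interior, under the integral sign
  have hη2 : ∀ k, Continuous fun y ↦ η k y ^ 2 := fun k ↦ (hηs k).continuous.pow 2
  have hη2c : ∀ k, HasCompactSupport (fun y ↦ η k y ^ 2) := fun k ↦ by
    rw [show (fun y ↦ η k y ^ 2) = fun y ↦ η k y * η k y from funext fun y ↦ sq (η k y)]
    exact (hηc k).mul_right
  have hswapF : ContinuousOn (Function.uncurry fun t y ↦ g.gradSq (φ t) y * Real.exp (-φ t y) *
      Real.exp (-V y)) (S ×ˢ univ) := by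
    have h1 := hFfam.continuousOn.comp continuous_swap.continuousOn
      (fun (q : ℝ × M) (hq : q ∈ S ×ˢ (univ : Set M)) ↦ show q.swap ∈ univ ×ˢ S from ⟨mem_univ _, hq.1⟩)
    exact h1.congr (by rintro ⟨t, y⟩ _; rfl)
  have hswapF' : ContinuousOn (Function.uncurry fun t y ↦ derivWithin (fun s ↦ g.gradSq (φ s) y *
      Real.exp (-φ s y) * Real.exp (-V y)) S t) (Ioo 0 T ×ˢ univ) := by
    have h1 := hF'fam.continuousOn.comp continuous_swap.continuousOn
      (fun (q : ℝ × M) (hq : q ∈ Ioo 0 T ×ˢ (univ : Set M)) ↦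
        show q.swap ∈ univ ×ˢ S from ⟨mem_univ _, Ioo_subset_Icc_self hq.1⟩)
    exact h1.congr (by rintro ⟨t, y⟩ _; rfl)
  have f6 : ∀ k, ContinuousOn (A k) S := fun k ↦ by
    have h := Literature.Analysis.FluidPDE.continuousOn_integral_smul_of_continuousOn (μ := μ)
      (hη2 k) (hη2c k) hswapF
    simp only [smul_eq_mul] at h
    exact h
  have f7 : ∀ k, ∀ t ∈ Ioo 0 T, HasDerivAt (A k) (DA k t) t := by
    intro k t ht
    have hder : ∀ s ∈ Ioo 0 T, ∀ y, HasDerivAt (fun r ↦ g.gradSq (φ r) y * Real.exp (-φ r y) * Real.exp (-V y))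
        (derivWithin (fun r ↦ g.gradSq (φ r) y * Real.exp (-φ r y) * Real.exp (-V y)) S s) s :=
      fun s hs y ↦ (hasDerivWithinAt_time_of_contMDiffOn (k := ∞) (u := fun t y ↦ g.gradSq (φ t) y *
        Real.exp (-φ t y) * Real.exp (-V y)) (by simp) hFfam y (Ioo_subset_Icc_self hs)).hasDerivAt
        (Icc_mem_nhds hs.1 hs.2)
    have h := Literature.Analysis.FluidPDE.hasDerivAt_integral_smul_of_continuousOn (μ := μ)
      (hη2 k) (hη2c k) isOpen_Ioo (hswapF.mono (prod_mono Ioo_subset_Icc_self le_rfl)) hswapF' hder ht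
    simp only [smul_eq_mul] at h
    exact h
  -- the exponential weight
  set CK : ℝ := Real.exp (2 * |K| * T) with hCK
  have hexle : ∀ t ∈ S, Real.exp (2 * K * t) ≤ CK := fun t ht ↦ by
    refine Real.exp_le_exp.2 ?_
    have h1 : 2 * K * t ≤ 2 * |K| * t := by nlinarith [le_abs_self K, ht.1]
    have h2 : 2 * |K| * t ≤ 2 * |K| * T := by nlinarith [abs_nonneg K, ht.2]
    linarith
  have hexd : ∀ t, HasDerivAt (fun s ↦ Real.exp (2 * K * s)) (Real.exp (2 * K * t) * (2 * K)) t := fun t ↦ by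
    have h1 : HasDerivAt (fun s : ℝ ↦ 2 * K * s) (2 * K) t := by simpa using (hasDerivAt_id t).const_mul (2 * K)
    exact h1.exp
  -- (main) `e^{2Kt} A_k(t) ≤ A_k(0) + t CK ε_k J_max` on `S`
  have hmain : ∀ k, ∀ t ∈ S, Real.exp (2 * K * t) * A k t ≤ A k 0 + t * (CK * ε k * Jmax) := by
    intro k t ht
    set Θ : ℝ → ℝ := fun s ↦ Real.exp (2 * K * s) * A k s - s * (CK * ε k * Jmax) with hΘ
    have hcontΘ : ContinuousOn Θ S :=
      ((Real.continuous_exp.comp (continuous_const.mul continuous_id)).continuousOn.mul (f6 k)).sub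
        (continuous_id.mul continuous_const).continuousOn
    have hdiffΘ : ∀ s ∈ Ioo 0 T, HasDerivAt Θ (Real.exp (2 * K * s) * (2 * K) * A k s
        + Real.exp (2 * K * s) * DA k s - CK * ε k * Jmax) s := fun s hs ↦ by
      have h1 : HasDerivAt (fun s' ↦ Real.exp (2 * K * s') * A k s')
          (Real.exp (2 * K * s) * (2 * K) * A k s + Real.exp (2 * K * s) * DA k s) s :=
        (hexd s).mul (f7 k s hs)
      have h2 : HasDerivAt (fun s' : ℝ ↦ s' * (CK * ε k * Jmax)) (CK * ε k * Jmax) s := by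
        simpa using hasDerivAt_mul_const (CK * ε k * Jmax) (x := s)
      exact h1.sub h2
    have hΘanti : AntitoneOn Θ S := by
      refine antitoneOn_of_deriv_nonpos (convex_Icc 0 T) hcontΘ (fun s hs ↦ ?_) (fun s hs ↦ ?_)
      · rw [interior_Icc] at hs
        exact (hdiffΘ s hs).differentiableAt.differentiableWithinAt
      · rw [interior_Icc] at hs
        have hsS : s ∈ S := Ioo_subset_Icc_self hs
        rw [(hdiffΘ s hs).deriv]
        have h1 := f1 k s hsS
        have hexp0 : 0 ≤ Real.exp (2 * K * s) := (Real.exp_pos _).le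
        have h2 : Real.exp (2 * K * s) * DA k s ≤ Real.exp (2 * K * s) * (-2 * K * A k s + ε k * J s) :=
          mul_le_mul_of_nonneg_left h1 hexp0
        have h3 : Real.exp (2 * K * s) * (ε k * J s) ≤ CK * (ε k * Jmax) :=
          mul_le_mul (hexle s hsS) (mul_le_mul_of_nonneg_left (hJle s hsS) (hε0 k))
            (mul_nonneg (hε0 k) (hJ0 s hsS)) (Real.exp_pos _).le
        nlinarith [h2, h3]
    have h0S : (0 : ℝ) ∈ S := ⟨le_rfl, hT.le⟩
    have hΘle : Θ t ≤ Θ 0 := hΘanti h0S ht ht.1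
    simp only [hΘ, mul_zero, Real.exp_zero, one_mul, zero_mul, sub_zero] at hΘle
    linarith
  -- `A_k(0) ≤ J(0)`
  have hsq1 : ∀ k y, η k y ^ 2 ≤ 1 := fun k y ↦ pow_le_one₀ (hη01 k y).1 (hη01 k y).2
  have hA0 : ∀ k, A k 0 ≤ J 0 := fun k ↦ by
    refine integral_mono_of_nonneg (Eventually.of_forall fun y ↦ ?_) (hFint 0 ⟨le_rfl, hT.le⟩)
      (Eventually.of_forall fun y ↦ ?_)
    · exact mul_nonneg (sq_nonneg _) (mul_nonneg (hFbd 0 ⟨le_rfl, hT.le⟩ y).1 (Real.exp_pos _).le)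
    · exact mul_le_of_le_one_left (mul_nonneg (hFbd 0 ⟨le_rfl, hT.le⟩ y).1 (Real.exp_pos _).le) (hsq1 k y)
  -- `k → ∞`: `A_k(t₀) → J(t₀)` and `ε_k → 0`
  have hlimA : Tendsto (fun k ↦ A k t₀) atTop (𝓝 (J t₀)) := by
    refine tendsto_integral_of_dominated_convergence _ (fun k ↦ ((hη2 k).mul (hFc t₀ ht₀)).aestronglyMeasurable)
      (hFint t₀ ht₀) (fun k ↦ Eventually.of_forall fun y ↦ ?_) (Eventually.of_forall fun y ↦ ?_)
    · have h0 := mul_nonneg (hFbd t₀ ht₀ y).1 (Real.exp_pos (-V y)).le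
      rw [Real.norm_eq_abs, abs_of_nonneg (mul_nonneg (sq_nonneg _) h0)]
      exact mul_le_of_le_one_left h0 (hsq1 k y)
    · have h := (tendsto_cutoff_of_eventually_eq hη1 y).pow 2
      simpa using h.mul_const (g.gradSq (φ t₀) y * Real.exp (-φ t₀ y) * Real.exp (-V y))
  have hlimε : Tendsto ε atTop (𝓝 0) := by
    have h1 : Tendsto (fun k : ℕ ↦ (k : ℝ) + 1) atTop atTop :=
      tendsto_atTop_add_const_right _ 1 (tendsto_natCast_atTop_atTop (R := ℝ))
    have hδ : Tendsto δ atTop (𝓝 0) := tendsto_const_nhds.div_atTop h1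
    have h := ((hδ.pow 2).const_mul 2).add ((hδ.mul_const L₀).const_mul 2)
    simp only [mul_zero, zero_pow two_ne_zero, zero_mul, add_zero] at h
    refine h.congr fun k ↦ ?_
    simp only [hεdef]; ring
  have hlimR : Tendsto (fun k ↦ J 0 + t₀ * (CK * ε k * Jmax)) atTop (𝓝 (J 0 + t₀ * (CK * 0 * Jmax))) :=
    tendsto_const_nhds.add (((hlimε.const_mul CK).mul_const Jmax).const_mul t₀)
  have hfin : Real.exp (2 * K * t₀) * J t₀ ≤ J 0 := by
    have h1 : Tendsto (fun k ↦ Real.exp (2 * K * t₀) * A k t₀) atTop (𝓝 (Real.exp (2 * K * t₀) * J t₀)) :=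
      hlimA.const_mul _
    have h2 := le_of_tendsto_of_tendsto' h1 hlimR fun k ↦ (hmain k t₀ ht₀).trans (by linarith [hA0 k])
    simpa using h2
  -- back to `u`
  have hJu : ∀ t ∈ S, J t = ∫ y, g.gradSq (u t) y / u t y * Real.exp (-V y) ∂μ := fun t ht ↦
    integral_congr_ae (Eventually.of_forall fun y ↦ by dsimp only; rw [hFu t ht y])
  rw [← hJu t₀ ht₀, ← hJu 0 ⟨le_rfl, hT.le⟩]
  have hinv : Real.exp (-2 * K * t₀) * Real.exp (2 * K * t₀) = 1 := by
    rw [← Real.exp_add, show -2 * K * t₀ + 2 * K * t₀ = 0 by ring, Real.exp_zero]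
  calc J t₀ = Real.exp (-2 * K * t₀) * (Real.exp (2 * K * t₀) * J t₀) := by rw [← mul_assoc, hinv, one_mul]
    _ ≤ Real.exp (-2 * K * t₀) * J 0 := mul_le_mul_of_nonneg_left hfin (Real.exp_pos _).le

end FisherDecay

end Literature.Geometry.Riemannian.BakryEmeryComplete

end Part6

/-!
## Part 7 — port of `Summits/SmoothPoincare4/SmoothPoincare4/Theorems/EntropyRungBakryEmeryLogSobolevEntropyProduction.lean` (1 declarations kept)

# Integrated entropy production along the weighted heat flow on a complete `CD(K,∞)` manifold

Setting: `M` modelled on `ℝⁿ` (Hausdorff, second countable, `T₃`, Borel — NOT compact), `g` Riemannian with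
its Levi-Civita connection, `V` smooth with `e^{-V} ∈ L¹` and `Ric_g + Hess V ≥ K g`, `K > 0`,
`L = Δ_g − g⁻¹(dV, d·)`, Gaffney cut-offs `η_k` (`0 ≤ η_k ≤ 1`, `η_k → 1`, `|∇η_k|² ≤ C₀/(k+1)²`).

`gaffney_entropyProduction` — for `u` smooth on `M × O` (`O ⊇ [0, T]` open), `∂ₛu = Lu`, `0 < a ≤ u ≤ b` and
`|∇u|² ≤ C_G` on `[0, T]`:
`∫ u(0) log u(0) e^{-V} − ∫ u(T) log u(T) e^{-V} ≤ (1/2K) ∫ |∇u(0)|²/u(0) e^{-V}`.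
Proof: the cut-off de Bruijn identity `|d/dt ∫ η_k² u log u e^{-V} + ∫ η_k² |∇u|²/u e^{-V}| ≤ ε_k`
(`entropyCutoffSq_le`, `ε_k = 2(1+Λ) √C₀/(k+1) √C_G ∫e^{-V}`), the Fisher decay
`∫ |∇u(t)|²/u(t) e^{-V} ≤ e^{-2Kt} ∫ |∇u(0)|²/u(0) e^{-V}` (`gaffney_fisherDecay`), monotonicity of
`t ↦ ∫ η_k² u log u e^{-V} − (J₀/2K) e^{-2Kt} + ε_k t` on `[0, T]`, and `k → ∞` by dominated convergence.
Everything is proved; no definitions.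

## References

* [BakryGentilLedoux2014] D. Bakry, I. Gentil, M. Ledoux (2014), Thm. 5.2.1 / Prop. 5.7.1 and §5.7
  (pp. 236–240, 268–270), with §3.2 (pp. 141–147) for the cut-offs.
* [BakryEmery1985] D. Bakry, M. Émery, *Diffusions hypercontractives* (1985).
-/

section Part7

open scoped _root_.Manifold _root_.ContDiff _root_.ENNReal _root_.NNReal _root_.Topology
open _root_.MeasureTheory _root_.Set _root_.Filter
open Literature.Geometry.Lorentzian Literature.Geometry.Riemannian

namespace Literature.Geometry.Riemannian.BakryEmeryComplete

open NoncompactShrinkerGapHeat NoncompactShrinkerGapHeat.CutoffToolkit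

section EntropyProduction

variable {n : ℕ} {M : Type*} [TopologicalSpace M] [T2Space M] [SecondCountableTopology M]
  [ChartedSpace (EuclideanSpace ℝ (Fin n)) M] [IsManifold (𝓡 n) ∞ M] [T3Space M]
  [MeasurableSpace M] [BorelSpace M]
  {g : PseudoRiemannianMetric (𝓡 n) ∞ (EuclideanSpace ℝ (Fin n)) (TangentSpace (𝓡 n) : M → Type _)}
  [g.HasLeviCivita]

/-- **Integrated entropy production along the weighted heat flow on a complete `CD(K,∞)` manifold,
`K > 0`** (see the module docstring): for `u` smooth on `M × O`, `∂ₛu = Lu` on `[0,T]`, `0 < a ≤ u ≤ b`,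
`|∇u|² ≤ C_G` on `[0,T] × M`, `e^{-V} ∈ L¹`, and Gaffney cut-offs,
`∫ u(0) log u(0) e^{-V} − ∫ u(T) log u(T) e^{-V} ≤ (1/2K) ∫ |∇u(0)|²/u(0) e^{-V}`.
[cite: BakryGentilLedoux2014, Thm. 5.2.1, Prop. 5.7.1 (pp. 236–240, 268)] [cite: BakryEmery1985] -/
theorem gaffney_entropyProduction (hg : g.IsRiemannian) {V : M → ℝ} {K : ℝ}
    (hV : ContMDiff (𝓡 n) 𝓘(ℝ, ℝ) ∞ V)
    (hRic : ∀ (y : M) (X : TangentSpace (𝓡 n) y), K * g.val y X X ≤ g.ricci y X X + g.hessian V y X X)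
    (hK : 0 < K) (hw : Integrable (fun y ↦ Real.exp (-V y)) g.riemVolume)
    {η : ℕ → M → ℝ} {C₀ : ℝ} (hηs : ∀ k, ContMDiff (𝓡 n) 𝓘(ℝ, ℝ) ∞ (η k))
    (hηc : ∀ k, HasCompactSupport (η k)) (hη01 : ∀ k x, 0 ≤ η k x ∧ η k x ≤ 1)
    (hη1 : ∀ x, ∀ᶠ k in atTop, η k x = 1)
    (hηgrad : ∀ k x, g.gradSq (η k) x ≤ C₀ / ((k : ℝ) + 1) ^ 2)
    {T : ℝ} {O : Set ℝ} {u : ℝ → M → ℝ} (hT : 0 < T) (hO : IsOpen O) (hTO : Icc 0 T ⊆ O)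
    (hu : ContMDiffOn ((𝓡 n).prod 𝓘(ℝ, ℝ)) 𝓘(ℝ, ℝ) ∞ (fun p : M × ℝ ↦ u p.2 p.1) (univ ×ˢ O))
    (heq : ∀ s ∈ Icc 0 T, ∀ x, deriv (fun r ↦ u r x) s = g.dalembertian (u s) x
      - g.innerDual x (mvfderiv (𝓡 n) V x).toLinearMap (mvfderiv (𝓡 n) (u s) x).toLinearMap)
    {a b CG : ℝ} (ha : 0 < a) (hab : ∀ s ∈ Icc 0 T, ∀ x, a ≤ u s x ∧ u s x ≤ b)
    (hG : ∀ s ∈ Icc 0 T, ∀ x, g.gradSq (u s) x ≤ CG) :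
    (∫ y, u 0 y * Real.log (u 0 y) * Real.exp (-V y) ∂g.riemVolume)
      - ∫ y, u T y * Real.log (u T y) * Real.exp (-V y) ∂g.riemVolume ≤
      1 / (2 * K) * ∫ y, g.gradSq (u 0) y / u 0 y * Real.exp (-V y) ∂g.riemVolume := by
  haveI := CarrilloNi2009_shrinkerLSI.isFiniteMeasureOnCompacts_riemVolume hg
  set μ : Measure M := g.riemVolume with hμ
  -- the time set `S = [0, T]`
  set S : Set ℝ := Icc 0 T with hSdef
  have hS : UniqueDiffOn ℝ S := uniqueDiffOn_Icc hT
  have h0S : (0 : ℝ) ∈ S := ⟨le_rfl, hT.le⟩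
  have hTS : T ∈ S := ⟨hT.le, le_rfl⟩
  have huS : ContMDiffOn ((𝓡 n).prod 𝓘(ℝ, ℝ)) 𝓘(ℝ, ℝ) ∞ (fun p : M × ℝ ↦ u p.2 p.1) (univ ×ˢ S) :=
    hu.mono (prod_mono le_rfl hTO)
  have hpos : ∀ t ∈ S, ∀ y, 0 < u t y := fun t ht y ↦ ha.trans_le (hab t ht y).1
  have hslice : ∀ t ∈ S, ContMDiff (𝓡 n) 𝓘(ℝ, ℝ) ∞ (u t) := fun t ht ↦
    huS.comp_contMDiff (contMDiff_id.prodMk contMDiff_const) fun y ↦ ⟨mem_univ _, ht⟩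
  -- the equation within `S`
  have hdS : ∀ t ∈ S, ∀ y, HasDerivAt (fun r ↦ u r y) (deriv (fun r ↦ u r y) t) t := fun t ht y ↦
    hasDerivAt_slice_of_contMDiffOn hO (v := fun p : M × ℝ ↦ u p.2 p.1) hu y (hTO ht)
  have heqS : ∀ t ∈ S, ∀ y, derivWithin (fun r ↦ u r y) S t = g.dalembertian (u t) y
      - g.innerDual y (mvfderiv (𝓡 n) V y).toLinearMap (mvfderiv (𝓡 n) (u t) y).toLinearMap := by
    intro t ht y
    rw [(hdS t ht y).differentiableAt.derivWithin (hS t ht)]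
    exact heq t ht y
  -- the entropy integrand `E(t, y) = u log u e^{-V}`, jointly smooth on `M × S`
  have hEfam : ContMDiffOn ((𝓡 n).prod 𝓘(ℝ, ℝ)) 𝓘(ℝ, ℝ) ∞ (fun p : M × ℝ ↦
      u p.2 p.1 * Real.log (u p.2 p.1) * Real.exp (-V p.1)) (univ ×ˢ S) := by
    have hlog : ContMDiffOn ((𝓡 n).prod 𝓘(ℝ, ℝ)) 𝓘(ℝ, ℝ) ∞ (fun p : M × ℝ ↦ Real.log (u p.2 p.1))
        (univ ×ˢ S) := by
      intro p hp
      have hne : u p.2 p.1 ≠ 0 := (hpos p.2 hp.2 p.1).ne'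
      exact (Real.contDiffAt_log.2 hne).comp_contMDiffWithinAt (f := fun p : M × ℝ ↦ u p.2 p.1) (x := p)
        (huS p hp)
    have hwf : ContMDiffOn ((𝓡 n).prod 𝓘(ℝ, ℝ)) 𝓘(ℝ, ℝ) ∞ (fun p : M × ℝ ↦ Real.exp (-V p.1)) (univ ×ˢ S) :=
      ((Real.contDiff_exp.comp contDiff_neg).comp_contMDiff (hV.comp contMDiff_fst)).contMDiffOn
    exact (huS.mul hlog).mul hwf
  have hE'fam := contMDiffOn_derivWithin_time_of_uniqueDiffOn (u := fun t y ↦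
      u t y * Real.log (u t y) * Real.exp (-V y)) hS hEfam
  -- constants and pointwise bounds
  have hC₀ : ∀ y : M, 0 ≤ C₀ := fun y ↦ by
    have h1 := hηgrad 0 y
    have h2 : 0 ≤ g.gradSq (η 0) y := g.gradSq_nonneg hg _ _
    rcases div_nonneg_iff.1 (h2.trans h1) with h | h
    · exact h.1
    · exact absurd h.2 (not_le.mpr (by positivity))
  set Λ : ℝ := max |Real.log a| |Real.log b| with hΛ
  have hlogbd : ∀ t ∈ S, ∀ y, |Real.log (u t y)| ≤ Λ := by
    intro t ht y
    have h1 : Real.log a ≤ Real.log (u t y) := Real.log_le_log ha (hab t ht y).1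
    have h2 : Real.log (u t y) ≤ Real.log b := Real.log_le_log (hpos t ht y) (hab t ht y).2
    refine abs_le.2 ⟨?_, ?_⟩
    · have := neg_abs_le (Real.log a)
      linarith [le_max_left |Real.log a| |Real.log b|]
    · linarith [le_abs_self (Real.log b), le_max_right |Real.log a| |Real.log b|]
  have hEbd : ∀ t ∈ S, ∀ y, |u t y * Real.log (u t y) * Real.exp (-V y)| ≤ b * Λ * Real.exp (-V y) := by
    intro t ht y
    have hb0 : 0 ≤ b := ha.le.trans ((hab t ht y).1.trans (hab t ht y).2)
    rw [abs_mul, abs_mul, abs_of_nonneg (Real.exp_pos _).le, abs_of_nonneg (hpos t ht y).le]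
    exact mul_le_mul_of_nonneg_right (mul_le_mul (hab t ht y).2 (hlogbd t ht y) (abs_nonneg _) hb0)
      (Real.exp_pos _).le
  -- the Fisher informations `J t`, nonnegative, bounded by the decay estimate
  have hWc : Continuous fun y ↦ Real.exp (-V y) := Real.continuous_exp.comp hV.continuous.neg
  have hQc : ∀ t ∈ S, Continuous fun y ↦ g.gradSq (u t) y / u t y := fun t ht ↦
    (contMDiff_gradSq g (hslice t ht)).continuous.div (hslice t ht).continuous fun y ↦ (hpos t ht y).ne'
  have hQbd : ∀ t ∈ S, ∀ y, 0 ≤ g.gradSq (u t) y / u t y ∧ g.gradSq (u t) y / u t y ≤ CG / a := by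
    intro t ht y
    have hQ0 : 0 ≤ g.gradSq (u t) y := g.gradSq_nonneg hg _ _
    have hρpos := hpos t ht y
    refine ⟨div_nonneg hQ0 hρpos.le, ?_⟩
    rw [div_le_div_iff₀ hρpos ha]
    nlinarith [hG t ht y, (hab t ht y).1]
  have hQint : ∀ t ∈ S, Integrable (fun y ↦ g.gradSq (u t) y / u t y * Real.exp (-V y)) μ := by
    intro t ht
    refine (hw.const_mul (CG / a)).mono' ((hQc t ht).mul hWc).aestronglyMeasurable
      (Eventually.of_forall fun y ↦ ?_)
    rw [Real.norm_eq_abs, abs_of_nonneg (mul_nonneg (hQbd t ht y).1 (Real.exp_pos _).le)]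
    exact mul_le_mul_of_nonneg_right (hQbd t ht y).2 (Real.exp_pos _).le
  set J : ℝ → ℝ := fun t ↦ ∫ y, g.gradSq (u t) y / u t y * Real.exp (-V y) ∂μ with hJdef
  have hJ0 : ∀ t ∈ S, 0 ≤ J t := fun t ht ↦ integral_nonneg fun y ↦ mul_nonneg (hQbd t ht y).1 (Real.exp_pos _).le
  have hJdecay : ∀ t ∈ S, J t ≤ Real.exp (-2 * K * t) * J 0 := fun t ht ↦
    gaffney_fisherDecay hg hV hRic hw hηs hηc hη01 hη1 hηgrad hT hO hTO hu heq ha hab hG t ht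
  -- the entropies `H t`
  have hEc : ∀ t ∈ S, Continuous fun y ↦ u t y * Real.log (u t y) * Real.exp (-V y) := fun t ht ↦
    (hEfam.continuousOn.comp_continuous (continuous_id.prodMk continuous_const) fun y ↦ ⟨mem_univ _, ht⟩ :)
  set H : ℝ → ℝ := fun t ↦ ∫ y, u t y * Real.log (u t y) * Real.exp (-V y) ∂μ with hHdef
  -- the cut-off entropies `B k`, their derivatives `DB k`, the cut-off Fisher informations `A k`, errors `ε k`
  set B : ℕ → ℝ → ℝ := fun k t ↦ ∫ y, η k y ^ 2 * (u t y * Real.log (u t y) * Real.exp (-V y)) ∂μ with hBdef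
  set DB : ℕ → ℝ → ℝ := fun k t ↦ ∫ y, η k y ^ 2 * derivWithin (fun s ↦ u s y * Real.log (u s y) *
      Real.exp (-V y)) S t ∂μ with hDBdef
  set A : ℕ → ℝ → ℝ := fun k t ↦ ∫ y, η k y ^ 2 * (g.gradSq (u t) y / u t y * Real.exp (-V y)) ∂μ with hAdef
  set δ : ℕ → ℝ := fun k ↦ Real.sqrt C₀ / ((k : ℝ) + 1) with hδdef
  have hδ0 : ∀ k, 0 ≤ δ k := fun k ↦ div_nonneg (Real.sqrt_nonneg _) (by positivity)
  have hδgrad : ∀ k y, g.gradSq (η k) y ≤ δ k ^ 2 := fun k y ↦ by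
    simp only [hδdef]
    rw [div_pow, Real.sq_sqrt (hC₀ y)]
    exact hηgrad k y
  set W₀ : ℝ := ∫ y, Real.exp (-V y) ∂μ with hW₀
  set ε : ℕ → ℝ := fun k ↦ 2 * (1 + Λ) * δ k * Real.sqrt CG * W₀ with hεdef
  have hηabs : ∀ k y, |η k y| ≤ 1 := fun k y ↦ abs_le.2 ⟨by linarith [(hη01 k y).1], (hη01 k y).2⟩
  have hsq1 : ∀ k y, η k y ^ 2 ≤ 1 := fun k y ↦ pow_le_one₀ (hη01 k y).1 (hη01 k y).2
  -- (e1) the cut-off de Bruijn inequality: `DB k t ≥ -A k t - ε k ≥ -e^{-2Kt} J 0 - ε k`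
  have hAle : ∀ k, ∀ t ∈ S, A k t ≤ J t := fun k t ht ↦ by
    refine integral_mono_of_nonneg (Eventually.of_forall fun y ↦ ?_) (hQint t ht)
      (Eventually.of_forall fun y ↦ ?_)
    · exact mul_nonneg (sq_nonneg _) (mul_nonneg (hQbd t ht y).1 (Real.exp_pos _).le)
    · exact mul_le_of_le_one_left (mul_nonneg (hQbd t ht y).1 (Real.exp_pos _).le) (hsq1 k y)
  have e1 : ∀ k, ∀ t ∈ S, -(Real.exp (-2 * K * t) * J 0) - ε k ≤ DB k t := by
    intro k t ht
    have h : |DB k t + A k t| ≤ ε k :=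
      entropyCutoffSq_le hg hV hw hS huS heqS (hηs k) (hηc k) (hηabs k) (hδ0 k) (hδgrad k) ht ha
        (hab t ht) (hG t ht)
    have h3 := (abs_le.1 h).1
    linarith [hAle k t ht, hJdecay t ht]
  -- (e2), (e3): continuity on `S`, differentiability on the interior, under the integral sign
  have hη2 : ∀ k, Continuous fun y ↦ η k y ^ 2 := fun k ↦ (hηs k).continuous.pow 2
  have hη2c : ∀ k, HasCompactSupport (fun y ↦ η k y ^ 2) := fun k ↦ by
    rw [show (fun y ↦ η k y ^ 2) = fun y ↦ η k y * η k y from funext fun y ↦ sq (η k y)]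
    exact (hηc k).mul_right
  have hswapE : ContinuousOn (Function.uncurry fun t y ↦ u t y * Real.log (u t y) * Real.exp (-V y))
      (S ×ˢ univ) := by
    have h1 := hEfam.continuousOn.comp continuous_swap.continuousOn
      (fun (q : ℝ × M) (hq : q ∈ S ×ˢ (univ : Set M)) ↦ show q.swap ∈ univ ×ˢ S from ⟨mem_univ _, hq.1⟩)
    exact h1.congr (by rintro ⟨t, y⟩ _; rfl)
  have hswapE' : ContinuousOn (Function.uncurry fun t y ↦ derivWithin (fun s ↦ u s y * Real.log (u s y) *
      Real.exp (-V y)) S t) (Ioo 0 T ×ˢ univ) := by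
    have h1 := hE'fam.continuousOn.comp continuous_swap.continuousOn
      (fun (q : ℝ × M) (hq : q ∈ Ioo 0 T ×ˢ (univ : Set M)) ↦
        show q.swap ∈ univ ×ˢ S from ⟨mem_univ _, Ioo_subset_Icc_self hq.1⟩)
    exact h1.congr (by rintro ⟨t, y⟩ _; rfl)
  have e2 : ∀ k, ContinuousOn (B k) S := fun k ↦ by
    have h := Literature.Analysis.FluidPDE.continuousOn_integral_smul_of_continuousOn (μ := μ)
      (hη2 k) (hη2c k) hswapE
    simp only [smul_eq_mul] at h
    exact h
  have e3 : ∀ k, ∀ t ∈ Ioo 0 T, HasDerivAt (B k) (DB k t) t := by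
    intro k t ht
    have hder : ∀ s ∈ Ioo 0 T, ∀ y, HasDerivAt (fun r ↦ u r y * Real.log (u r y) * Real.exp (-V y))
        (derivWithin (fun r ↦ u r y * Real.log (u r y) * Real.exp (-V y)) S s) s :=
      fun s hs y ↦ (hasDerivWithinAt_time_of_contMDiffOn (k := ∞) (u := fun t y ↦ u t y * Real.log (u t y) *
        Real.exp (-V y)) (by simp) hEfam y (Ioo_subset_Icc_self hs)).hasDerivAt (Icc_mem_nhds hs.1 hs.2)
    have h := Literature.Analysis.FluidPDE.hasDerivAt_integral_smul_of_continuousOn (μ := μ)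
      (hη2 k) (hη2c k) isOpen_Ioo (hswapE.mono (prod_mono Ioo_subset_Icc_self le_rfl)) hswapE' hder ht
    simp only [smul_eq_mul] at h
    exact h
  -- the exponential primitive
  have hexd : ∀ t, HasDerivAt (fun s ↦ Real.exp (-2 * K * s)) (Real.exp (-2 * K * t) * (-2 * K)) t := fun t ↦ by
    have h1 : HasDerivAt (fun s : ℝ ↦ -2 * K * s) (-2 * K) t := by simpa using (hasDerivAt_id t).const_mul (-2 * K)
    exact h1.exp
  -- (main) `B k 0 - B k T ≤ J 0 / (2K) + T ε k`
  have hmain : ∀ k, B k 0 - B k T ≤ J 0 / (2 * K) + T * ε k := by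
    intro k
    set Θ : ℝ → ℝ := fun s ↦ B k s - J 0 / (2 * K) * Real.exp (-2 * K * s) + ε k * s with hΘ
    have hcontΘ : ContinuousOn Θ S :=
      ((e2 k).sub (continuous_const.mul (Real.continuous_exp.comp (continuous_const.mul
        continuous_id))).continuousOn).add (continuous_const.mul continuous_id).continuousOn
    have hdiffΘ : ∀ s ∈ Ioo 0 T, HasDerivAt Θ (DB k s - J 0 / (2 * K) * (Real.exp (-2 * K * s) * (-2 * K))
        + ε k) s := fun s hs ↦ by
      have h2 : HasDerivAt (fun s' : ℝ ↦ ε k * s') (ε k) s := by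
        simpa using (hasDerivAt_id s).const_mul (ε k)
      exact ((e3 k s hs).sub ((hexd s).const_mul _)).add h2
    have hΘmono : MonotoneOn Θ S := by
      refine monotoneOn_of_deriv_nonneg (convex_Icc 0 T) hcontΘ (fun s hs ↦ ?_) (fun s hs ↦ ?_)
      · rw [interior_Icc] at hs
        exact (hdiffΘ s hs).differentiableAt.differentiableWithinAt
      · rw [interior_Icc] at hs
        have hsS : s ∈ S := Ioo_subset_Icc_self hs
        rw [(hdiffΘ s hs).deriv]
        have h1 := e1 k s hsS
        have hK' : J 0 / (2 * K) * (Real.exp (-2 * K * s) * (-2 * K)) = -(Real.exp (-2 * K * s) * J 0) := by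
          rw [show J 0 / (2 * K) * (Real.exp (-2 * K * s) * (-2 * K))
              = -(Real.exp (-2 * K * s) * J 0) * ((2 * K) / (2 * K)) by ring, div_self (by positivity), mul_one]
        rw [hK']
        linarith
    have hΘle : Θ 0 ≤ Θ T := hΘmono h0S hTS hT.le
    simp only [hΘ, mul_zero, Real.exp_zero, mul_one, add_zero] at hΘle
    have hpos' : 0 ≤ J 0 / (2 * K) * Real.exp (-2 * K * T) :=
      mul_nonneg (div_nonneg (hJ0 0 h0S) (by positivity)) (Real.exp_pos _).le
    nlinarith [hΘle, hpos']
  -- `k → ∞`: `B k t → H t` (dominated convergence) and `ε k → 0`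
  have hlimB : ∀ t ∈ S, Tendsto (fun k ↦ B k t) atTop (𝓝 (H t)) := by
    intro t ht
    refine tendsto_integral_of_dominated_convergence (fun y ↦ b * Λ * Real.exp (-V y))
      (fun k ↦ ((hη2 k).mul (hEc t ht)).aestronglyMeasurable)
      (hw.const_mul (b * Λ)) (fun k ↦ Eventually.of_forall fun y ↦ ?_) (Eventually.of_forall fun y ↦ ?_)
    · rw [Real.norm_eq_abs, abs_mul, abs_of_nonneg (sq_nonneg (η k y))]
      calc η k y ^ 2 * |u t y * Real.log (u t y) * Real.exp (-V y)|
          ≤ 1 * (b * Λ * Real.exp (-V y)) :=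
            mul_le_mul (hsq1 k y) (hEbd t ht y) (abs_nonneg _) zero_le_one
        _ = b * Λ * Real.exp (-V y) := one_mul _
    · have h := (tendsto_cutoff_of_eventually_eq hη1 y).pow 2
      simpa using h.mul_const (u t y * Real.log (u t y) * Real.exp (-V y))
  have hlimε : Tendsto ε atTop (𝓝 0) := by
    have h1 : Tendsto (fun k : ℕ ↦ (k : ℝ) + 1) atTop atTop :=
      tendsto_atTop_add_const_right _ 1 (tendsto_natCast_atTop_atTop (R := ℝ))
    have hδ : Tendsto δ atTop (𝓝 0) := tendsto_const_nhds.div_atTop h1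
    have h := ((hδ.const_mul (2 * (1 + Λ))).mul_const (Real.sqrt CG)).mul_const W₀
    simp only [mul_zero, zero_mul] at h
    exact h
  have hlimL : Tendsto (fun k ↦ B k 0 - B k T) atTop (𝓝 (H 0 - H T)) := (hlimB 0 h0S).sub (hlimB T hTS)
  have hlimR : Tendsto (fun k ↦ J 0 / (2 * K) + T * ε k) atTop (𝓝 (J 0 / (2 * K) + T * 0)) :=
    tendsto_const_nhds.add (hlimε.const_mul T)
  have hfin := le_of_tendsto_of_tendsto' hlimL hlimR hmain
  rw [mul_zero, add_zero] at hfin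
  calc H 0 - H T ≤ J 0 / (2 * K) := hfin
    _ = 1 / (2 * K) * J 0 := by ring

end EntropyProduction

end Literature.Geometry.Riemannian.BakryEmeryComplete

end Part7

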